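import Literature.MathematicalPhysics.QuantumFieldTheory.Balaban1983to89.B9Thm34GKernelFinal

/-!
# `Balaban1983to89.B9Thm34RFinal` — [Balaban1985BackgroundPropagators] THEOREM 3.4 p. 400, THE `R(U)`-CLAUSE: (3.68) FOR `P′(A)` AND (3.49) FOR
# `P(U′U) = P(U) + P′(A) = I − R(U′U)` WITH THE PRINTED QUANTIFIERS `∃ α₁ > 0 ∃ K ∀ A` (block-majorant form) — FILE 27 of the Sect. B programme of
# cell `lit-balaban`, seat r06 (B9 fold owner) gen 14; the twin chain of FILE 25 `B9Thm34GKernelFinal` with the (3.77)-conclusion replaced by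
# the eight (3.49)/(3.68) entries

statement-level skeleton of published theorems with citation tags; proofs where landed; nothing here is a claim about the Yang–Mills mass gap

CITATION HEADER (lean-in-tree rule).  B9 = T. Bałaban, *Propagators for lattice gauge theories in a background field*, Commun. Math. Phys. **99** (1985)
389–434 (journal page = PDF page + 388).  Theorem 3.4 p. 400 [PDF 12] «There exists a positive constant a₁ such that the operators G′(U), (Q′(U)G′²(U)Q′*(U))⁻¹, R(U), G(U) extend to configurations U′U for
α₁ ≦ a₁ as analytic functions of A. The extended operators satisfy all the inequalities of Theorems 3.1–3.3 correspondingly»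
(verbatim p. 400 [PDF 12] L7–10; «for α₁ sufficiently small» is pp. 401–403, «of course with different constants» is p. 403 [PDF 15] L5 —
docfix r06 g14 for S-B9-g38-2 / S-B9-g42-1 / CITELOC18: the earlier guillemet text here was a paraphrase, not the print); p. 403 [PDF 15], before and at (3.68): «These results imply that the operators R(U), P(U) = I − R(U) extend analytically to the
domain (3.37) and satisfy the same bounds, e.g. the operator P(U′U) satisfies the bounds (3.49). Moreover we have P(U′U) = P(U) + P′(A),
|P′(A;x,x′)|, |(DP′(A))_μ(x,x′)|, |(P′(A)D*)_ν(x,x′)|, |(DP′(A)D*)_{μν}(x,x′)| ≦ O(1)α₁[1, (Lʲη)⁻¹, (Lʲη)⁻¹, (Lʲη)⁻²](L^{j′}η)^{−d}e^{−(1/2)δ₀d(y,y′)}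
… (3.68)»; (3.49) p. 399 [PDF 11] «[|P(x,x′)|, |(DP)_μ(x,x′)|, |(PD*)_ν(x,x′)|, |(DPD*)_{μν}(x,x′)|] ≦ O(1)[1, (Lʲη)⁻¹, (Lʲη)⁻¹, (Lʲη)⁻²](L^{j′}η)^{−d}
e^{−(1/2)δ₀d(y,y′)}» and «These theorems [3.1, 3.2] imply all the properties of the operator R … using again Lemma 2.1»; (3.25) p. 394 (`P = I − R =
G′Q′*(Q′G′²Q′*)⁻¹Q′G′`); (3.57)–(3.67) pp. 401–403; Thm 3.1 (3.42) p. 397; Thm 3.2 (3.48) p. 398; (3.37) p. 396.  [4] = [Balaban1984PropagatorsII]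
Lemma 2.1 p. 234, (2.51)–(2.55) p. 232, (2.66) p. 234; [B11] = [Balaban1985Variational] (135) p. 298.  Rows B9.Eq3.68 × B9.Thm3.4 × B9.Eq3.49 ×
B9.Eq3.66 (cells only; no row head changes).

WHAT IS PROVED (0 `def`, 0 sorry, 0 new named facts).  `D = conjHom b (gradLin T η⁻¹ U)`, `D* = conjHom b (divLin T η⁻¹ U)` (the (3.76) letters of
FILE 10 `B9Eq376POneLetters`, site carrier → bond carrier and back); every entry in the block-majorant form of [4] (2.51)–(2.55).
* §1 `hasMajorant_pPrime_site` — FILE 25's `hasMajorant_pOne_site` with its last step (FILE 11/12 `ineq377_concreteE`) removed: from Theorem 3.1's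
  (3.42)₁₋₃ for `G′(U)` (rate `δ_G`), the (3.19)/(3.57)/(3.59) letters, Theorem 3.2's (3.48) for `C⁻¹(U)`, `C⁻¹(U′U)` and (3.66)/(3.67) as site
  endomorphisms, the concrete `V′(A)` of (3.60) and (3.37) blockwise: THE FOUR ENTRIES (3.49) OF `P(U) = G′Q′*C⁻¹Q′G′` — `P ≺ κ_P e^{−δ_Pd}`,
  `D·P ≺ κ_P(Lʲη)⁻¹e^{−δ_Pd}`, `P·D* ≺ κ_P(Lʲη)⁻¹e^{−δ_Pd}`, `D·P·D* ≺ κ_P(Lʲη)⁻²e^{−δ_Pd}` (FILE 12 `ineq349_hom`) — AND THE FOUR ENTRIES (3.68) OF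
  `P′(A) = pPrime G′ G′(U′U) Q′* Q′*(U′U) C⁻¹ C⁻¹(U′U) Q′ Q′(U′U)` — the same with `κ_{P′}·α₁` (gen 9/10 `B9Ineq368Vprime.ineq368_op{,_D,_Ds,_DDs}_conc`,
  their four explicit constants dominated by `κ_{P′}`).
* §1 `hasMajorant_pPrime_coarse` — the same with the coarse-lattice letters in their own typing read through a section `rep` (FILES 17/18).
* §2 `exists_cinv_pPrime_concrete` — «The inverse satisfies Theorem 3.2» (gen 9 `inverse_satisfies_thm32_vPrime`) + (3.66)/(3.67) for the
  concrete `V′(A)` ⇒ `∃ C⁻¹(U′U)` two-sided inverse of `Q′(U′U)G′²(U′U)Q′*(U′U)` AND the eight entries for the `P′(A)` built with it (FILE 25 §2's proof).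
* §3 `exists_threshold_pPrime` — the printed quantifiers `∃ a₁ > 0 ∃ K ≧ 0 ∀ α₁ ≦ a₁ ∀ A …` by FILE 20/25's rate cascade (`δ_P = δ₀/4`, `δ_G =
  7δ₀/20`, `δ₁ = δ₀`, `ρ_c = 49δ₀/50`, `ρ₁ = 33δ₀/100`, exponents `1/100`, `α_v = α₃ = 1/10`) and thresholds by continuity at `α₁ = 0`; the
  constant `κ_{P′}(α₁)` (explicit, continuous at `0`) bounded by `K` below a threshold (FILE 25 `exists_bound_of_continuousAt`).
* §4 **`thm34_R_final`** — THE `R(U)`-CLAUSE OF THEOREM 3.4 for the concrete perturbation: `∃ a₁ > 0 ∃ K ≧ 0 ∀ α₁ ≦ a₁ ∀ A` in (3.37) (blockwise)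
  `∀` (3.57)/(3.59) letters: `∃ C⁻¹(U′U)` (two-sided inverse) such that (3.68) `P′(A) ≺ Kα₁e^{−(δ₀/4)d}`, `D·P′(A), P′(A)·D* ≺ Kα₁(Lʲη)⁻¹e^{−(δ₀/4)d}`,
  `D·P′(A)·D* ≺ Kα₁(Lʲη)⁻²e^{−(δ₀/4)d}` AND (3.49) for `P(U′U) := pOp G′(U′U) Q′*(U′U) C⁻¹(U′U) Q′(U′U) = G′(U′U)Q′*(U′U)C⁻¹(U′U)Q′(U′U)G′(U′U)`
  (`= P(U) + P′(A)`, `B9Eq360Vprime.eq368`) with the constant `K` — inputs = Theorem 3.1 (3.42)₁₋₃ for `G′(U)` and Theorem 3.2 for `U` at the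
  rate `δ₀`, [4] Lemma 2.1 and the p. 398 scale transfer for every exponent, the (3.19) letters, the `A`-free (3.60) data (the hypotheses of
  FILE 25's `exists_threshold_pOne` verbatim).

HONEST SCOPE / NOT CLAIMED.  As FILES 20/24/25/26: Theorems 3.1/3.2 FOR `U` are inputs («These theorems imply all the properties of the operator R»,
p. 399; «assume Theorem 3.1 is valid for G′(U)», p. 402); the derivatives in (3.49)/(3.68) are the covariant `D = ∇_U`, `D* = ∇*_U` of the
background `U` exactly as printed in (3.68) (Sect. B's (3.74)–(3.77) then trades `∇_{U′U}` for `∇_U` + first-order letters — FILES 10–12, 25);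
block-majorant form only (the printed `(L^{j′}η)^{−d}` kernel shape would need the letters in kernel form, cf. FILES 21–25 for `G(U′U)`); the
«corresponding bounds for Hölder norms of the kernel (DPD*)» (p. 399) are not covered (G-B9-02); `a₁`, `K` packaged existentially AFTER the
lattice is fixed (values depend on the constants only, FILE 20 (iii)); the rate `δ₀/4` is ONE admissible choice («of course with different constants», p. 403;
print: `½δ₀` from inputs at `δ₀` — the cell's Lemma-2.1 bookkeeping loses a fixed fraction per composition); (3.37) read blockwise in the shapes
of FILES 1–19; no row head changes (B9.Eq3.68 and B9.Eq3.49 are proved-existing rows since gens 5/9/10; this file adds the printed quantifiers).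

RELATED IN THE TREE, NOT DUPLICATED (searched 2026-08-22: `lean search 'pPrime_site|pPrime_coarse|cinv_pPrime|threshold_pPrime|thm34_R_final' --decl`
= ∅): FILE 25 `B9Thm34GKernelFinal` (the (3.77) chain; `exists_bound_of_continuousAt` USED BY NAME), FILE 12 `B9Ineq349Hom.ineq349_hom`, gen 9/10
`B9Ineq368Vprime`, gen 9 `B9Ineq366Vprime`, FILES 17/18 `B6RandomWalkSection`; the proofs of §1–§3 are FILE 25's with the last step removed
(generator `lit-balaban-r06/lean/gen27.py`, line-range extraction from the tree — no hand-typed signatures).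
-/

noncomputable section

namespace Literature.MathematicalPhysics.QuantumFieldTheory.Balaban1983to89.B9Thm34RFinal

open NormedSpace Complex
open Literature.MathematicalPhysics.QuantumFieldTheory.Balaban1983to89
open Literature.MathematicalPhysics.QuantumFieldTheory.Balaban1983to89.B6RandomWalk (HasMajorant hasMajorant_mono Triangle254 Ineq261)
open Literature.MathematicalPhysics.QuantumFieldTheory.Balaban1983to89.B6RandomWalkHom (HasMajorantHom hasMajorantHom_mono hasMajorantHom_iff)
open Literature.MathematicalPhysics.QuantumFieldTheory.Balaban1983to89.B6RandomWalkKernel (HasKernelBound hasKernelBound_mono)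
open Literature.MathematicalPhysics.QuantumFieldTheory.Balaban1983to89.B9Thm34Ext (toB6)
open Literature.MathematicalPhysics.QuantumFieldTheory.Balaban1983to89.B9Ineq347 (ScaleTransfer)
open Literature.MathematicalPhysics.QuantumFieldTheory.Balaban1983to89.B9Ineq366CPrime (hasMajorant_rate_mono cPrimeHom kappa366 kappa366_nonneg
  kappa366_pos)
open Literature.MathematicalPhysics.QuantumFieldTheory.Balaban1983to89.B9Eq386Neumann (pTwo deltaA)
open Literature.MathematicalPhysics.QuantumFieldTheory.Balaban1983to89.B9Ineq377POne (kappa377 kappa377_nonneg)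
open Literature.MathematicalPhysics.QuantumFieldTheory.Balaban1983to89.B9Ineq385VG (kappa383 kappa383_nonneg kappa385 kappa385_nonneg)
open Literature.MathematicalPhysics.QuantumFieldTheory.Balaban1983to89.B9Eq39Adjoint
open Literature.MathematicalPhysics.QuantumFieldTheory.Balaban1983to89.B9Eq369Small (Through)
open Literature.MathematicalPhysics.QuantumFieldTheory.Balaban1983to89.B9Eq372Locality (stBonds)
open Literature.MathematicalPhysics.QuantumFieldTheory.Balaban1983to89.B9Eq352DivForm (tauF tauB)
open Literature.MathematicalPhysics.QuantumFieldTheory.Balaban1983to89.B9Eq352DivFormLetters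
open Literature.MathematicalPhysics.QuantumFieldTheory.Balaban1983to89.B9Eq352GradLetters (diffLetter)
open Literature.MathematicalPhysics.QuantumFieldTheory.Balaban1983to89.B9Eq371GradLetters (bT bU)
open Literature.MathematicalPhysics.QuantumFieldTheory.Balaban1983to89.B9Eq372RemLetters (lapDDLetter)
open Literature.MathematicalPhysics.QuantumFieldTheory.Balaban1983to89.B9Eq382V3Letters (dPrimeLetter)
open Literature.MathematicalPhysics.QuantumFieldTheory.Balaban1983to89.B9Eq376POneLetters (conjHom gradLin divLin)
open Literature.MathematicalPhysics.QuantumFieldTheory.Balaban1983to89.B9Ineq385V3Concrete (cV385 cV385_nonneg)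
open Literature.MathematicalPhysics.QuantumFieldTheory.Balaban1983to89.B9Ineq377POneConcrete (ineq377_concreteE)
open Literature.MathematicalPhysics.QuantumFieldTheory.Balaban1983to89.B9Ineq349Hom (ineq349_hom)
open Literature.MathematicalPhysics.QuantumFieldTheory.Balaban1983to89.B9Ineq368PPrime (kappa349 kappa368)
open Literature.MathematicalPhysics.QuantumFieldTheory.Balaban1983to89.B9Ineq368PPrimeDs (kappa368Ds kappa368Ds_nonneg kappa368_nonneg kappa349_nonneg)
open Literature.MathematicalPhysics.QuantumFieldTheory.Balaban1983to89.B9Eq360Vprime (gPrimeExtEnd eq365_end_left eq365_end opNorm_lt_one_of_363_261)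
open Literature.MathematicalPhysics.QuantumFieldTheory.Balaban1983to89.B9Eq360VprimeLetters (vPrimeConc cBConc cCConc)
open Literature.MathematicalPhysics.QuantumFieldTheory.Balaban1983to89.B9Ineq363Vprime (cVConc cVConc_nonneg theta363 thetaL363 theta363_nonneg
  thetaL363_nonneg ineq363_op_vPrime)
open Literature.MathematicalPhysics.QuantumFieldTheory.Balaban1983to89.B9Ineq368Vprime (ineq368_op_conc ineq368_op_D_conc ineq368_op_Ds_conc
  ineq368_op_DDs_conc)
open Literature.MathematicalPhysics.QuantumFieldTheory.Balaban1983to89.B9Eq376DerivDict (hasMajorantHom_gradLin_comp hasMajorantHom_gradLin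
  hasMajorantHom_comp_divLin hasMajorantHom_divLin hasMajorant_gradLin_comp_comp_divLin)
open Literature.MathematicalPhysics.QuantumFieldTheory.Balaban1983to89.B6RandomWalkSection
open Literature.MathematicalPhysics.QuantumFieldTheory.Balaban1983to89.B9Ineq366Vprime (eq365b_hom hasMajorant_cPrimeHom_vPrime
  inverse_satisfies_thm32_vPrime)
open Literature.MathematicalPhysics.QuantumFieldTheory.Balaban1983to89.B9Thm34GFinal (ineq261_rescale scaleTransfer_rescale c1_pos_of_ineq261
  exists_threshold_of_continuousAt)
open Literature.MathematicalPhysics.QuantumFieldTheory.Balaban1983to89.B9Thm34GKernelFinal (exists_bound_of_continuousAt)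

/-! ## §1  (3.49) for `P(U)` and (3.68) for the concrete `P′(A)` as theorems (site letters; coarse letters through a section) -/

section PPrime

variable {𝔸 : Type*} [NormedRing 𝔸] [NormedAlgebra ℂ 𝔸] [CompleteSpace 𝔸] {ι : Type} [Fintype ι]
variable (b : Module.Basis ι ℝ 𝔸) {S : Type} {κ : Type} [Fintype κ] [LinearOrder κ]
variable (T : κ → Equiv.Perm S) (U : κ → S → 𝔸ˣ)
variable {g : B9.Geometry} [Fintype g.Site] {Rr : ℝ} {H : Prop}

omit [LinearOrder κ] in
set_option maxHeartbeats 800000 in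
/-- **(3.49) FOR `P(U)` AND (3.68) FOR THE CONCRETE `P′(A)`, SITE-CARRIER LETTERS** — FILE 25's `hasMajorant_pOne_site` without its last step: from
Theorem 3.1's (3.42)₁₋₃ for `G′(U)` (rate `δ_G`), the block-local letters `Q′, Q′*, F′₂, F′₂*` ((3.19), (3.57), (3.59)), Theorem 3.2's (3.48) for `C⁻¹(U)`
and for `C⁻¹(U′U)`, (3.66) for `C′(A)` in the resolvent form (3.67) — all as site endomorphisms —, the concrete `V′(A)` data of (3.60) and (3.37)
blockwise: the four entries (3.49) of `P(U) = G′Q′*C⁻¹Q′G′` at `(κ_P, δ_P)` (`κ_P = κ₃₄₉(κ_Q, (1 + #κ)B_G, B₁, Λ, c₁(β))`, FILE 12 `ineq349_hom`) and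
the four entries (3.68) of `P′(A) = pPrime G′ G′(U′U) Q′* Q′*(U′U) C⁻¹ C⁻¹(U′U) Q′ Q′(U′U)` at `(κ_{P′}·α₁, δ_P)` (gen 9/10
`ineq368_op{,_D,_Ds,_DDs}_conc`, constants dominated by `κ_{P′}`: `hK1`, `hK3`); rates `δ_P + (2α+β)δ₀ ≦ δ_G`, `δ_P + 2(2α+β)δ₀ ≦ (1−3α″)ρ₁`.
[cite: Balaban1985BackgroundPropagators, (3.49) p.399 + (3.68) p.403 + (3.25) p.394 + (3.19) p.393 + (3.57) p.401 + (3.59) p.402 + (3.65)–(3.67) pp.402–403 + Thm 3.1 (3.42) p.397 + Thm 3.2 (3.48) p.398 + (3.37) p.396 + Thm 3.4 p.400; Balaban1984PropagatorsII, Lemma 2.1 p.234 + (2.51)–(2.55) p.232 + (2.66) p.234; Balaban1985Variational, (135) p.298] -/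
theorem hasMajorant_pPrime_site [Fintype S] [DecidableEq S] [DecidableEq ι] [DecidableEq g.Site] (blk : S → g.Site) (d : ℕ)
    (δ₀ δP δG α β ρ₁ α'' Λ Λρ₁ κQ BG B₁ Bc' κC cF Cq a₀ κP κP' α₁ d₀ M₂ : ℝ)
    (kQ kF : g.Site → S → 𝔸 →L[ℝ] 𝔸) (sQ sF : S → 𝔸 →L[ℝ] 𝔸) (cfun w : g.Site → ℝ)
    (hκQ : 0 ≤ κQ) (hBG : 0 ≤ BG) (hB₁ : 0 ≤ B₁) (hBc' : 0 ≤ Bc') (hκC : 0 ≤ κC) (hcF : 0 ≤ cF) (hCq : 0 ≤ Cq) (ha₀ : 0 ≤ a₀)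
    (hα₁ : 0 ≤ α₁) (hΛ : 1 ≤ Λ) (hα : 0 ≤ α) (hβ : 0 ≤ β) (hδ₀ : 0 ≤ δ₀) (hδP0 : 0 ≤ δP) (hM₂ : 0 ≤ M₂)
    (hrG : δP + (2 * α + β) * δ₀ ≤ δG)
    (hr1 : ρ₁ + (α + β) * δ₀ ≤ δG) (hα''1 : α'' ≤ 1) (hα''0 : 0 ≤ α'') (hρ₁ : 0 ≤ ρ₁) (hα''ρ : 0 ≤ (1 - α'') * ρ₁)
    (hα''ρ2 : 0 ≤ (1 - 2 * α'') * ρ₁) (hα''ρ3 : 0 ≤ (1 - 3 * α'') * ρ₁) (hΛρ₁ : 0 ≤ Λρ₁)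
    (hr368 : δP + 2 * ((2 * α + β) * δ₀) ≤ B9Ineq368Vprime.rateC α'' ρ₁)
    (hκP : κP = kappa349 κQ ((1 + Fintype.card κ) * BG) B₁ Λ (B6.c1 d δ₀ β))
    (hdnn : ∀ a a' : g.Site, 0 ≤ g.dist a a') (htri : Triangle254 (toB6 g Rr H)) (hrefl : ∀ y : g.Site, g.dist y y = 0)
    (hsym : ∀ y y' : g.Site, g.dist y y' = g.dist y' y) (hlen : ∀ y : g.Site, 0 < g.len y)
    (h261 : Ineq261 d (toB6 g Rr H) δ₀ β) (h261'' : Ineq261 d (toB6 g Rr H) ρ₁ α'')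
    (hT1 : ScaleTransfer g δ₀ α Λ (fun a => g.len a)) (hT2 : ScaleTransfer g δ₀ α Λ (fun a => g.len a ^ 2))
    (hT1i : ScaleTransfer g δ₀ α Λ (fun a => (g.len a)⁻¹)) (hT2i : ScaleTransfer g δ₀ α Λ (fun a => (g.len a ^ 2)⁻¹))
    (hT4 : ScaleTransfer g δ₀ α Λ (fun a => (g.len a ^ 4)⁻¹))
    (hTρ₁ : ScaleTransfer g ρ₁ α'' Λρ₁ (fun a => g.len a))
    (hrepr : ∀ (v : 𝔸) (i : ι), |b.repr v i| ≤ M₂ * ‖v‖) (hη : 0 < g.eta) (A : κ → S → 𝔸)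
    (hsmall : ∀ y : g.Site, g.eta * (α₁ * (g.len y)⁻¹) ≤ 1 / 4)
    (hU1 : ∀ m z, ‖((U m z : 𝔸ˣ) : 𝔸)‖ ≤ 1 ∧ ‖(((U m z)⁻¹ : 𝔸ˣ) : 𝔸)‖ ≤ 1)
    -- (3.37) for the exponent field, blockwise, in the shapes the (3.68)/(3.77) files read it
    (h337B : ∀ ν k x, ‖((g.eta : ℂ)⁻¹) • covDstar T U ν (A k) x‖ ≤ α₁ * (g.len (blk x) ^ 2)⁻¹)
    (h337F : ∀ μ ν x, ‖((g.eta : ℂ)⁻¹) • covD T U μ (A ν) x‖ ≤ α₁ * (g.len (blk x) ^ 2)⁻¹)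
    (h337Bτ : ∀ μ x, ‖((g.eta : ℂ)⁻¹) • covDstar T U μ (tauB T U μ (A μ)) x‖ ≤ α₁ * (g.len (blk x) ^ 2)⁻¹)
    (hA : ∀ k x, ‖A k x‖ ≤ α₁ * (g.len (blk x))⁻¹) (hAτB : ∀ ν k x, ‖tauB T U ν (A k) x‖ ≤ α₁ * (g.len (blk x))⁻¹)
    -- stencil geometry
    (hd₀B : ∀ μ x, g.dist (blk x) (blk ((T μ).symm x)) ≤ d₀) (hd₀F : ∀ μ x, g.dist (blk x) (blk (T μ x)) ≤ d₀)
    (hd₀0 : ∀ y : g.Site, g.dist y y ≤ d₀)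
    -- the letters of `P(U)` and `P′(A)` on the site carrier (FILE 16's block), at the rate `δ_G`
    {Gp Qp Qps Qp' Qps' Fp₂ Fp₂s Cinv Cinv' Cp : Module.End ℝ (S × ι → ℝ)}
    (h342_1 : HasMajorant (g := toB6 g Rr H) (fun p : S × ι => blk p.1) Gp
      (fun a a' => BG * g.len a ^ 2 * Real.exp (-(δG * g.dist a a'))))
    (h342_2 : ∀ k : κ ⊕ κ, HasMajorant (g := toB6 g Rr H) (fun p : S × ι => blk p.1)
      (conj b (diffLetter T U ((g.eta : ℂ)⁻¹) k) * Gp) (fun a a' => BG * g.len a * Real.exp (-(δG * g.dist a a'))))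
    (h342_3 : ∀ k : κ ⊕ κ, HasMajorant (g := toB6 g Rr H) (fun p : S × ι => blk p.1)
      (Gp * conj b (diffLetter T U ((g.eta : ℂ)⁻¹) k)) (fun a a' => BG * g.len a * Real.exp (-(δG * g.dist a a'))))
    (h357p : Qp' = Qp + Fp₂) (h357ps : Qps' = Qps + Fp₂s) (hCC : Cinv' - Cinv = -(Cinv' * Cp * Cinv))
    (hQp : HasMajorant (g := toB6 g Rr H) (fun p : S × ι => blk p.1) Qp (fun a a' : g.Site => if a = a' then κQ else 0))
    (hQps : HasMajorant (g := toB6 g Rr H) (fun p : S × ι => blk p.1) Qps (fun a a' : g.Site => if a = a' then κQ else 0))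
    (hFp : HasMajorant (g := toB6 g Rr H) (fun p : S × ι => blk p.1) Fp₂ (fun a a' : g.Site => if a = a' then cF * α₁ else 0))
    (hFps : HasMajorant (g := toB6 g Rr H) (fun p : S × ι => blk p.1) Fp₂s (fun a a' : g.Site => if a = a' then cF * α₁ else 0))
    (hCinv : HasMajorant (g := toB6 g Rr H) (fun p : S × ι => blk p.1) Cinv
      (fun a a' => B₁ * (g.len a ^ 4)⁻¹ * Real.exp (-(δG * g.dist a a'))))
    (hCinv' : HasMajorant (g := toB6 g Rr H) (fun p : S × ι => blk p.1) Cinv'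
      (fun a a' => Bc' * (g.len a ^ 4)⁻¹ * Real.exp (-(δG * g.dist a a'))))
    (hCp : HasMajorant (g := toB6 g Rr H) (fun p : S × ι => blk p.1) Cp
      (fun a a' => κC * α₁ * g.len a ^ 4 * Real.exp (-(δG * g.dist a a'))))
    -- the data of the CONCRETE `V′(A)` of (3.60) and the smallness/constant conditions of `B9Ineq363Vprime`/`B9Ineq368Vprime`
    (hw : ∀ y, 0 ≤ w y) (hcard : ∀ y, ((B9Eq360Vprime.block blk y).card : ℝ) * w y ≤ 1)
    (hkQ : ∀ y x, blk x = y → ‖kQ y x‖ ≤ w y) (hkF : ∀ y x, blk x = y → ‖kF y x‖ ≤ Cq * α₁ * w y)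
    (hsQ : ∀ x, ‖sQ x‖ ≤ 1) (hsF : ∀ x, ‖sF x‖ ≤ Cq * α₁) (hcfun : ∀ y, |cfun y| ≤ a₀ * (g.len y ^ 2)⁻¹)
    (hθ : theta363 (Fintype.card κ) 1 α₁ a₀ Cq M₂ (∑ i, ‖b i‖) (Real.exp (δG * d₀)) BG Λ (B6.c1 d δ₀ β) *
      B6.c1 d ρ₁ α'' < 1)
    (hθL : thetaL363 (Fintype.card κ) 1 α₁ a₀ Cq M₂ (∑ i, ‖b i‖) (Real.exp (δG * d₀)) BG Λ (B6.c1 d δ₀ β) *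
      B6.c1 d ρ₁ α'' < 1)
    -- the constant `κ_{P′}` of the (3.77)-step dominates the four explicit (3.68)-constants of `B9Ineq368Vprime`
    (hK1 : kappa368 κQ cF
        (kappa385 1 (cVConc (Fintype.card κ) 1 α₁ a₀ Cq M₂ (∑ i, ‖b i‖) (Real.exp (δG * d₀))) 0 0 Λ (B6.c1 d δ₀ β))
        κC BG BG (BG * B6.c1 d ρ₁ α'' *
          (1 - theta363 (Fintype.card κ) 1 α₁ a₀ Cq M₂ (∑ i, ‖b i‖) (Real.exp (δG * d₀)) BG Λ (B6.c1 d δ₀ β) * B6.c1 d ρ₁ α'')⁻¹)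
        B₁ Bc' Λ (B6.c1 d δ₀ β) α₁ ≤ κP')
    (hK3 : Fintype.card κ * kappa368Ds κQ cF
        (kappa385 BG (cVConc (Fintype.card κ) 1 α₁ a₀ Cq M₂ (∑ i, ‖b i‖) (Real.exp (δG * d₀))) 0 0 Λ (B6.c1 d δ₀ β))
        κC BG BG BG (B6.c1 d ρ₁ α'' *
          (1 - theta363 (Fintype.card κ) 1 α₁ a₀ Cq M₂ (∑ i, ‖b i‖) (Real.exp (δG * d₀)) BG Λ (B6.c1 d δ₀ β) * B6.c1 d ρ₁ α'')⁻¹)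
        (BG * Λρ₁ ^ 2 * B6.c1 d ρ₁ α'' *
          (1 - thetaL363 (Fintype.card κ) 1 α₁ a₀ Cq M₂ (∑ i, ‖b i‖) (Real.exp (δG * d₀)) BG Λ (B6.c1 d δ₀ β) * B6.c1 d ρ₁ α'')⁻¹)
        B₁ Bc' (cBConc (Fintype.card κ) M₂ (∑ i, ‖b i‖) (Real.exp (B9Ineq368Vprime.rateC α'' ρ₁ * d₀)))
        (cCConc (Fintype.card κ) 1 α₁ a₀ Cq M₂ (∑ i, ‖b i‖) (Real.exp (B9Ineq368Vprime.rateC α'' ρ₁ * d₀))) Λ (B6.c1 d δ₀ β) α₁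
        ≤ κP') :
    HasMajorant (g := toB6 g Rr H) (fun p : S × ι => blk p.1) (Gp ∘ₗ Qps ∘ₗ Cinv ∘ₗ Qp ∘ₗ Gp)
      (fun a a' => κP * Real.exp (-(δP * g.dist a a'))) ∧
    HasMajorantHom (g := toB6 g Rr H) (fun p : S × ι => blk p.1) (fun q : (κ × S) × ι => blk q.1.2)
      (conjHom b (gradLin T ((g.eta : ℂ)⁻¹) U) ∘ₗ (Gp ∘ₗ Qps ∘ₗ Cinv ∘ₗ Qp ∘ₗ Gp))
      (fun a a' => κP * (g.len a)⁻¹ * Real.exp (-(δP * g.dist a a'))) ∧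
    HasMajorantHom (g := toB6 g Rr H) (fun q : (κ × S) × ι => blk q.1.2) (fun p : S × ι => blk p.1)
      ((Gp ∘ₗ Qps ∘ₗ Cinv ∘ₗ Qp ∘ₗ Gp) ∘ₗ conjHom b (divLin T ((g.eta : ℂ)⁻¹) U))
      (fun a a' => κP * (g.len a)⁻¹ * Real.exp (-(δP * g.dist a a'))) ∧
    HasMajorant (g := toB6 g Rr H) (fun q : (κ × S) × ι => blk q.1.2)
      (conjHom b (gradLin T ((g.eta : ℂ)⁻¹) U) ∘ₗ (Gp ∘ₗ Qps ∘ₗ Cinv ∘ₗ Qp ∘ₗ Gp) ∘ₗ conjHom b (divLin T ((g.eta : ℂ)⁻¹) U))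
      (fun a a' => κP * (g.len a ^ 2)⁻¹ * Real.exp (-(δP * g.dist a a'))) ∧
    HasMajorant (g := toB6 g Rr H) (fun p : S × ι => blk p.1) (B9Eq360Vprime.pPrime Gp (gPrimeExtEnd Gp (conj b (vPrimeConc T U g.eta A blk kQ kF sQ sF cfun) * Gp)) Qps Qps' Cinv Cinv' Qp Qp')
      (fun a a' => κP' * α₁ * Real.exp (-(δP * g.dist a a'))) ∧
    HasMajorantHom (g := toB6 g Rr H) (fun p : S × ι => blk p.1) (fun q : (κ × S) × ι => blk q.1.2)
      (conjHom b (gradLin T ((g.eta : ℂ)⁻¹) U) ∘ₗ (B9Eq360Vprime.pPrime Gp (gPrimeExtEnd Gp (conj b (vPrimeConc T U g.eta A blk kQ kF sQ sF cfun) * Gp)) Qps Qps' Cinv Cinv' Qp Qp'))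
      (fun a a' => κP' * α₁ * (g.len a)⁻¹ * Real.exp (-(δP * g.dist a a'))) ∧
    HasMajorantHom (g := toB6 g Rr H) (fun q : (κ × S) × ι => blk q.1.2) (fun p : S × ι => blk p.1)
      ((B9Eq360Vprime.pPrime Gp (gPrimeExtEnd Gp (conj b (vPrimeConc T U g.eta A blk kQ kF sQ sF cfun) * Gp)) Qps Qps' Cinv Cinv' Qp Qp') ∘ₗ conjHom b (divLin T ((g.eta : ℂ)⁻¹) U))
      (fun a a' => κP' * α₁ * (g.len a)⁻¹ * Real.exp (-(δP * g.dist a a'))) ∧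
    HasMajorant (g := toB6 g Rr H) (fun q : (κ × S) × ι => blk q.1.2)
      (conjHom b (gradLin T ((g.eta : ℂ)⁻¹) U) ∘ₗ (B9Eq360Vprime.pPrime Gp (gPrimeExtEnd Gp (conj b (vPrimeConc T U g.eta A blk kQ kF sQ sF cfun) * Gp)) Qps Qps' Cinv Cinv' Qp Qp') ∘ₗ conjHom b (divLin T ((g.eta : ℂ)⁻¹) U))
      (fun a a' => κP' * α₁ * (g.len a ^ 2)⁻¹ * Real.exp (-(δP * g.dist a a'))) := by
  have hcardκ : (0 : ℝ) ≤ Fintype.card κ := Nat.cast_nonneg _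
  have hαβ : 0 ≤ (α + β) * δ₀ := mul_nonneg (add_nonneg hα hβ) hδ₀
  have h2αβ : 0 ≤ (2 * α + β) * δ₀ := mul_nonneg (add_nonneg (mul_nonneg zero_le_two hα) hβ) hδ₀
  have hδG0 : 0 ≤ δG := le_trans (le_trans hδP0 (le_add_of_nonneg_right h2αβ)) hrG
  have hBG' : 0 ≤ (1 + Fintype.card κ) * BG := mul_nonneg (add_nonneg zero_le_one hcardκ) hBG
  have hBGle : BG ≤ (1 + Fintype.card κ) * BG := by
    have h : (1 : ℝ) ≤ 1 + Fintype.card κ := le_add_of_nonneg_right hcardκ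
    simpa using mul_le_mul_of_nonneg_right h hBG
  have hκBGle : Fintype.card κ * BG ≤ (1 + Fintype.card κ) * BG :=
    mul_le_mul_of_nonneg_right (le_add_of_nonneg_left zero_le_one) hBG
  have hr368' : δP + 2 * ((2 * α + β) * δ₀) ≤ (1 - α'') * ρ₁ := by
    have h3 : B9Ineq368Vprime.rateC α'' ρ₁ ≤ (1 - α'') * ρ₁ := by
      have h4 : 0 ≤ 2 * α'' * ρ₁ := mul_nonneg (mul_nonneg zero_le_two hα''0) hρ₁
      unfold B9Ineq368Vprime.rateC
      linarith only [h4]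
    exact hr368.trans h3
  -- the shapes `B9Ineq368Vprime` reads (3.37)/(3.35)/stencil geometry in
  have hA' : ∀ μ x, ‖A μ x‖ ≤ α₁ * (g.len (blk x))⁻¹ ∧ ‖tauB T U μ (A μ) x‖ ≤ α₁ * (g.len (blk x))⁻¹ :=
    fun μ x => ⟨hA μ x, hAτB μ μ x⟩
  have h337s' : ∀ μ x, ‖((g.eta : ℂ)⁻¹) • covDstar T U μ (A μ) x‖ ≤ α₁ * (g.len (blk x) ^ 2)⁻¹ := fun μ x => h337B μ μ x
  have h337F' : ∀ μ x, ‖((g.eta : ℂ)⁻¹) • covD T U μ (A μ) x‖ ≤ α₁ * (g.len (blk x) ^ 2)⁻¹ := fun μ x => h337F μ μ x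
  have hd₀' : ∀ μ x, g.dist (blk x) (blk (T μ x)) ≤ d₀ ∧ g.dist (blk x) (blk ((T μ).symm x)) ≤ d₀ :=
    fun μ x => ⟨hd₀F μ x, hd₀B μ x⟩
  -- Theorem 3.1's entries for `G′(U)` in FILE 13's two-space shapes, common constant `(1 + card κ)B_G` (FILE 14)
  have hw1 : ∀ a : g.Site, 0 ≤ g.len a := fun a => (hlen a).le
  have hGp' : HasMajorant (g := toB6 g Rr H) (fun p : S × ι => blk p.1) Gp
      (fun a a' => (1 + Fintype.card κ) * BG * g.len a ^ 2 * Real.exp (-(δG * g.dist a a'))) :=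
    hasMajorant_mono _ h342_1 fun a a' =>
      mul_le_mul_of_nonneg_right (mul_le_mul_of_nonneg_right hBGle (sq_nonneg _)) (Real.exp_nonneg _)
  have hDGp' : HasMajorantHom (g := toB6 g Rr H) (fun p : S × ι => blk p.1) (fun q : (κ × S) × ι => blk q.1.2)
      (conjHom b (gradLin T ((g.eta : ℂ)⁻¹) U) ∘ₗ Gp) (fun a a' => (1 + Fintype.card κ) * BG * g.len a * Real.exp (-(δG * g.dist a a'))) :=
    hasMajorantHom_mono _ _ (hasMajorantHom_gradLin (R := Rr) (H := H) b T U blk ((g.eta : ℂ)⁻¹) fun μ => h342_2 (Sum.inl μ))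
      fun a a' => mul_le_mul_of_nonneg_right (mul_le_mul_of_nonneg_right hBGle (hw1 a)) (Real.exp_nonneg _)
  have hGpDs' : HasMajorantHom (g := toB6 g Rr H) (fun q : (κ × S) × ι => blk q.1.2) (fun p : S × ι => blk p.1)
      (Gp ∘ₗ conjHom b (divLin T ((g.eta : ℂ)⁻¹) U)) (fun a a' => (1 + Fintype.card κ) * BG * g.len a * Real.exp (-(δG * g.dist a a'))) :=
    hasMajorantHom_mono _ _ (hasMajorantHom_divLin (R := Rr) (H := H) b T U blk ((g.eta : ℂ)⁻¹) fun ν => h342_3 (Sum.inr ν))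
      fun a a' => by
        calc (Fintype.card κ : ℝ) * (BG * g.len a * Real.exp (-(δG * g.dist a a')))
            = Fintype.card κ * BG * g.len a * Real.exp (-(δG * g.dist a a')) := by ring
          _ ≤ (1 + Fintype.card κ) * BG * g.len a * Real.exp (-(δG * g.dist a a')) :=
            mul_le_mul_of_nonneg_right (mul_le_mul_of_nonneg_right hκBGle (hw1 a)) (Real.exp_nonneg _)
  have hQp' : HasMajorantHom (g := toB6 g Rr H) (fun p : S × ι => blk p.1) (fun p : S × ι => blk p.1) Qp
      (fun a a' : g.Site => if a = a' then κQ else 0) := (hasMajorantHom_iff (g := toB6 g Rr H) _ _ _).mpr hQp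
  have hQps' : HasMajorantHom (g := toB6 g Rr H) (fun p : S × ι => blk p.1) (fun p : S × ι => blk p.1) Qps
      (fun a a' : g.Site => if a = a' then κQ else 0) := (hasMajorantHom_iff (g := toB6 g Rr H) _ _ _).mpr hQps
  -- the four (3.68) entries of the CONCRETE `P′(A)` (gen 9/10), at the rate `δ_P`
  have e1 := ineq368_op_conc (Rr := Rr) (H := H) b T U blk d hη A kQ kF sQ sF cfun w 1 d₀ M₂ Cq a₀ δ₀ δG α β ρ₁ α'' δP Λ BG κQ cF κC B₁
    Bc' α₁ hκQ hcF hκC hB₁ hBc' hBG hα₁ hΛ hρ₁ hδP0 hα hβ hδ₀ hδG0 hr1 hα''0 hα''1 hr368' hdnn hrefl htri hlen h261 h261'' hT1 hT2 hT4 hM₂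
    hrepr hsmall hA' h337s' hU1 hd₀' hd₀0 hw hcard hCq ha₀ hkQ hkF hsQ hsF hcfun hθ h342_1 h342_2 h357p h357ps hCC hQp hQps hFp hFps hCinv
    hCinv' hCp
  have e2 : ∀ μ : κ, _ := fun μ =>
    ineq368_op_D_conc (Rr := Rr) (H := H) b T U blk d hη A kQ kF sQ sF cfun w 1 d₀ M₂ Cq a₀ δ₀ δG α β ρ₁ α'' δP Λ BG BG κQ cF κC
      B₁ Bc' α₁ hκQ hcF hκC hB₁ hBc' hBG hBG hα₁ hΛ hρ₁ hδP0 hα hβ hδ₀ hδG0 hr1 hα''0 hα''1 hr368' hdnn hrefl htri hlen h261 h261'' hT1 hT2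
      hT4 hM₂ hrepr hsmall hA' h337s' hU1 hd₀' hd₀0 hw hcard hCq ha₀ hkQ hkF hsQ hsF hcfun hθ (D₀ := conj b (diffLetter T U ((g.eta : ℂ)⁻¹) (Sum.inl μ)))
      (h342L := h342_2 (Sum.inl μ)) h342_1 h342_2 h357p h357ps hCC hQp hQps hFp hFps hCinv hCinv' hCp
  have e3 : ∀ ν : κ, _ := fun ν =>
    ineq368_op_Ds_conc (Rr := Rr) (H := H) b T U blk d hη A kQ kF sQ sF cfun w 1 d₀ M₂ Cq a₀ δ₀ δG α β ρ₁ α'' δP Λ Λρ₁ BG κQ cF κC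
      B₁ Bc' α₁ hκQ hcF hκC hB₁ hBc' hBG hα₁ hΛ hΛρ₁ hρ₁ hδP0 hα hβ hδ₀ hδG0 hr1 hα''1 hα''0 hα''ρ hα''ρ2 hα''ρ3 hr368 hdnn hrefl hsym htri
      hlen h261 h261'' hT1 hT2 hT1i hT2i hT4 hTρ₁ hM₂ hrepr hsmall hA' h337s' h337F' h337Bτ hU1 hd₀' hd₀0 hw hcard hCq ha₀ hkQ hkF hsQ hsF
      hcfun hθ hθL (Ds := conj b (diffLetter T U ((g.eta : ℂ)⁻¹) (Sum.inr ν))) h342_1 h342_2 h342_3 (h342R := h342_3 (Sum.inr ν)) h357p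
      h357ps hCC hQp hQps hFp hFps hCinv hCinv' hCp
  have e4 : ∀ μ ν : κ, _ := fun μ ν =>
    ineq368_op_DDs_conc (Rr := Rr) (H := H) b T U blk d hη A kQ kF sQ sF cfun w 1 d₀ M₂ Cq a₀ δ₀ δG α β ρ₁ α'' δP Λ Λρ₁ BG BG κQ cF
      κC B₁ Bc' α₁ hκQ hcF hκC hB₁ hBc' hBG hBG hα₁ hΛ hΛρ₁ hρ₁ hδP0 hα hβ hδ₀ hδG0 hr1 hα''1 hα''0 hα''ρ hα''ρ2 hα''ρ3 hr368 hdnn hrefl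
      hsym htri hlen h261 h261'' hT1 hT2 hT1i hT2i hT4 hTρ₁ hM₂ hrepr hsmall hA' h337s' h337F' h337Bτ hU1 hd₀' hd₀0 hw hcard hCq ha₀ hkQ hkF
      hsQ hsF hcfun hθ hθL (D₀ := conj b (diffLetter T U ((g.eta : ℂ)⁻¹) (Sum.inl μ)))
      (Ds := conj b (diffLetter T U ((g.eta : ℂ)⁻¹) (Sum.inr ν))) h342_1 h342_2 h342_3 (h342R := h342_3 (Sum.inr ν))
      (h342L := h342_2 (Sum.inl μ)) h357p h357ps hCC hQp hQps hFp hFps hCinv hCinv' hCp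
  dsimp only at e1 e2 e3 e4
  -- the four `P′`-entry hypotheses of FILE 13, constants weakened to `κ_{P′}`
  have hPp := hasMajorant_mono (g := toB6 g Rr H) _ e1 fun a a' =>
    mul_le_mul_of_nonneg_right (mul_le_mul_of_nonneg_right hK1 hα₁) (Real.exp_nonneg (-(δP * g.dist a a')))
  have hDPp := hasMajorantHom_gradLin_comp (R := Rr) (H := H) b T U blk ((g.eta : ℂ)⁻¹) fun μ =>
    hasMajorant_mono (g := toB6 g Rr H) _ (e2 μ) fun a a' =>
      mul_le_mul_of_nonneg_right (mul_le_mul_of_nonneg_right (mul_le_mul_of_nonneg_right hK1 hα₁) (inv_nonneg.mpr (hw1 a)))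
        (Real.exp_nonneg (-(δP * g.dist a a')))
  have aux : ∀ K a1 li e : ℝ, (Fintype.card κ : ℝ) * K ≤ κP' → 0 ≤ a1 → 0 ≤ li → 0 ≤ e →
      (Fintype.card κ : ℝ) * (K * a1 * li * e) ≤ κP' * a1 * li * e := by
    intro K a1 li e hK ha1 hli he
    calc (Fintype.card κ : ℝ) * (K * a1 * li * e) = Fintype.card κ * K * a1 * li * e := by ring
      _ ≤ κP' * a1 * li * e := mul_le_mul_of_nonneg_right (mul_le_mul_of_nonneg_right (mul_le_mul_of_nonneg_right hK ha1) hli) he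
  have hPpDs := hasMajorantHom_mono (g := toB6 g Rr H) _ _
    (hasMajorantHom_comp_divLin (R := Rr) (H := H) b T U blk ((g.eta : ℂ)⁻¹) e3) fun a a' =>
      aux _ _ _ _ hK3 hα₁ (inv_nonneg.mpr (hw1 a)) (Real.exp_nonneg (-(δP * g.dist a a')))
  have hDPpDs := hasMajorant_mono (g := toB6 g Rr H) _
    (hasMajorant_gradLin_comp_comp_divLin (R := Rr) (H := H) b T U blk ((g.eta : ℂ)⁻¹) e4) fun a a' =>
      aux _ _ _ _ hK3 hα₁ (inv_nonneg.mpr (sq_nonneg (g.len a))) (Real.exp_nonneg (-(δP * g.dist a a')))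
  -- FILE 13: the (3.49) entries of `P(U) = G′Q′*(Q′G′²Q′*)⁻¹Q′G′`, every letter between its carriers (FILE 12), at the rate `δ_P`
  have hκP0 : 0 ≤ κP := by
    rw [hκP]; unfold kappa349; positivity
  obtain ⟨hP, hDP, hPDs, hDPDs⟩ := ineq349_hom (R := Rr) (H := H) (fun p : S × ι => blk p.1) (fun q : (κ × S) × ι => blk q.1.2)
    (fun p : S × ι => blk p.1) d δ₀ δG α β δP Λ κQ ((1 + Fintype.card κ) * BG) B₁ hκQ hBG' hB₁ hΛ hδP0 hα hβ hδ₀ hrG hdnn htri hlen h261 hT1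
    hT2 hT4 hQp' hQps' hGp' hDGp' hGpDs' hCinv
  rw [← hκP] at hP hDP hPDs hDPDs
  exact ⟨hP, hDP, hPDs, hDPDs, hPp, hDPp, hPpDs, hDPpDs⟩

omit [LinearOrder κ] in
set_option maxHeartbeats 800000 in
/-- **(3.49) FOR `P(U)` AND (3.68) FOR THE CONCRETE `P′(A)`, COARSE-LATTICE LETTERS IN THEIR OWN TYPING** — `hasMajorant_pPrime_site` with
`Q′, F′₂ : sites → 𝔅`, `Q′*, F′₂* : 𝔅 → sites` block-local two-space letters, `C⁻¹(U)`, `C⁻¹(U′U)` given by Theorem 3.2's KERNEL bound (3.48) on 𝔅,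
`C′(A)` by its (3.66) block majorant on 𝔅 and (3.67) on 𝔅, read on the sites through a section `rep` of the block map (FILES 17/18's dictionary,
FILE 25's `hasMajorant_pOne_coarse` proof); `P(U) = G′ ∘ Q′* ∘ C⁻¹ ∘ Q′ ∘ G′` the genuine two-space word.
[cite: Balaban1985BackgroundPropagators, (3.49) p.399 + (3.68) p.403 + (3.25) p.394 + (3.19) p.393 + (3.57) p.401 + (3.59) p.402 + (3.65)–(3.67) pp.402–403 + Thm 3.1 (3.42) p.397 + Thm 3.2 (3.48) p.398 + (3.37) p.396 + Thm 3.4 p.400; Balaban1984PropagatorsII, Lemma 2.1 p.234 + (2.51)–(2.55) p.232 + (2.66) p.234; Balaban1985Variational, (135) p.298] -/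
theorem hasMajorant_pPrime_coarse [Fintype S] [DecidableEq S] [DecidableEq ι] [DecidableEq g.Site] (blk : S → g.Site) (d : ℕ)
    (δ₀ δP δG α β ρ₁ α'' Λ Λρ₁ κQ BG B₁ Bc' κC cF Cq a₀ κP κP' α₁ d₀ M₂ : ℝ)
    (kQ kF : g.Site → S → 𝔸 →L[ℝ] 𝔸) (sQ sF : S → 𝔸 →L[ℝ] 𝔸) (cfun w : g.Site → ℝ)
    (hκQ : 0 ≤ κQ) (hBG : 0 ≤ BG) (hB₁ : 0 ≤ B₁) (hBc' : 0 ≤ Bc') (hκC : 0 ≤ κC) (hcF : 0 ≤ cF) (hCq : 0 ≤ Cq) (ha₀ : 0 ≤ a₀)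
    (hα₁ : 0 ≤ α₁) (hΛ : 1 ≤ Λ) (hα : 0 ≤ α) (hβ : 0 ≤ β) (hδ₀ : 0 ≤ δ₀) (hδP0 : 0 ≤ δP) (hM₂ : 0 ≤ M₂)
    (hrG : δP + (2 * α + β) * δ₀ ≤ δG)
    (hr1 : ρ₁ + (α + β) * δ₀ ≤ δG) (hα''1 : α'' ≤ 1) (hα''0 : 0 ≤ α'') (hρ₁ : 0 ≤ ρ₁) (hα''ρ : 0 ≤ (1 - α'') * ρ₁)
    (hα''ρ2 : 0 ≤ (1 - 2 * α'') * ρ₁) (hα''ρ3 : 0 ≤ (1 - 3 * α'') * ρ₁) (hΛρ₁ : 0 ≤ Λρ₁)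
    (hr368 : δP + 2 * ((2 * α + β) * δ₀) ≤ B9Ineq368Vprime.rateC α'' ρ₁)
    (hκP : κP = kappa349 κQ ((1 + Fintype.card κ) * BG) B₁ Λ (B6.c1 d δ₀ β))
    (hdnn : ∀ a a' : g.Site, 0 ≤ g.dist a a') (htri : Triangle254 (toB6 g Rr H)) (hrefl : ∀ y : g.Site, g.dist y y = 0)
    (hsym : ∀ y y' : g.Site, g.dist y y' = g.dist y' y) (hlen : ∀ y : g.Site, 0 < g.len y)
    (h261 : Ineq261 d (toB6 g Rr H) δ₀ β) (h261'' : Ineq261 d (toB6 g Rr H) ρ₁ α'')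
    (hT1 : ScaleTransfer g δ₀ α Λ (fun a => g.len a)) (hT2 : ScaleTransfer g δ₀ α Λ (fun a => g.len a ^ 2))
    (hT1i : ScaleTransfer g δ₀ α Λ (fun a => (g.len a)⁻¹)) (hT2i : ScaleTransfer g δ₀ α Λ (fun a => (g.len a ^ 2)⁻¹))
    (hT4 : ScaleTransfer g δ₀ α Λ (fun a => (g.len a ^ 4)⁻¹))
    (hTρ₁ : ScaleTransfer g ρ₁ α'' Λρ₁ (fun a => g.len a))
    (hrepr : ∀ (v : 𝔸) (i : ι), |b.repr v i| ≤ M₂ * ‖v‖) (hη : 0 < g.eta) (A : κ → S → 𝔸)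
    (hsmall : ∀ y : g.Site, g.eta * (α₁ * (g.len y)⁻¹) ≤ 1 / 4)
    (hU1 : ∀ m z, ‖((U m z : 𝔸ˣ) : 𝔸)‖ ≤ 1 ∧ ‖(((U m z)⁻¹ : 𝔸ˣ) : 𝔸)‖ ≤ 1)
    (h337B : ∀ ν k x, ‖((g.eta : ℂ)⁻¹) • covDstar T U ν (A k) x‖ ≤ α₁ * (g.len (blk x) ^ 2)⁻¹)
    (h337F : ∀ μ ν x, ‖((g.eta : ℂ)⁻¹) • covD T U μ (A ν) x‖ ≤ α₁ * (g.len (blk x) ^ 2)⁻¹)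
    (h337Bτ : ∀ μ x, ‖((g.eta : ℂ)⁻¹) • covDstar T U μ (tauB T U μ (A μ)) x‖ ≤ α₁ * (g.len (blk x) ^ 2)⁻¹)
    (hA : ∀ k x, ‖A k x‖ ≤ α₁ * (g.len (blk x))⁻¹) (hAτB : ∀ ν k x, ‖tauB T U ν (A k) x‖ ≤ α₁ * (g.len (blk x))⁻¹)
    (hd₀B : ∀ μ x, g.dist (blk x) (blk ((T μ).symm x)) ≤ d₀) (hd₀F : ∀ μ x, g.dist (blk x) (blk (T μ x)) ≤ d₀)
    (hd₀0 : ∀ y : g.Site, g.dist y y ≤ d₀)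
    -- Theorem 3.1 (3.42)₁,₂,₃ for `G′(U)` at the rate `δ_G`
    {Gp : Module.End ℝ (S × ι → ℝ)}
    (h342_1 : HasMajorant (g := toB6 g Rr H) (fun p : S × ι => blk p.1) Gp
      (fun a a' => BG * g.len a ^ 2 * Real.exp (-(δG * g.dist a a'))))
    (h342_2 : ∀ k : κ ⊕ κ, HasMajorant (g := toB6 g Rr H) (fun p : S × ι => blk p.1)
      (conj b (diffLetter T U ((g.eta : ℂ)⁻¹) k) * Gp) (fun a a' => BG * g.len a * Real.exp (-(δG * g.dist a a'))))
    (h342_3 : ∀ k : κ ⊕ κ, HasMajorant (g := toB6 g Rr H) (fun p : S × ι => blk p.1)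
      (Gp * conj b (diffLetter T U ((g.eta : ℂ)⁻¹) k)) (fun a a' => BG * g.len a * Real.exp (-(δG * g.dist a a'))))
    -- the coarse-lattice letters in their own typing, read through the section `rep` (FILES 17/18)
    (rep : g.Site → S × ι) (hrep : ∀ y : g.Site, blk (rep y).1 = y)
    {Qc Qc' Fc : (S × ι → ℝ) →ₗ[ℝ] (g.Site → ℝ)} {Qcs Qcs' Fcs : (g.Site → ℝ) →ₗ[ℝ] (S × ι → ℝ)}
    {Linv Linv' Ccp : Module.End ℝ (g.Site → ℝ)}
    (h357 : Qc' = Qc + Fc) (h357s : Qcs' = Qcs + Fcs) (h367 : Linv' - Linv = -(Linv' * Ccp * Linv))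
    (hQc : HasMajorantHom (g := toB6 g Rr H) (fun p : S × ι => blk p.1) (fun y : g.Site => y) Qc
      (fun a a' : g.Site => if a = a' then κQ else 0))
    (hQcs : HasMajorantHom (g := toB6 g Rr H) (fun y : g.Site => y) (fun p : S × ι => blk p.1) Qcs
      (fun a a' : g.Site => if a = a' then κQ else 0))
    (hFc : HasMajorantHom (g := toB6 g Rr H) (fun p : S × ι => blk p.1) (fun y : g.Site => y) Fc
      (fun a a' : g.Site => if a = a' then cF * α₁ else 0))
    (hFcs : HasMajorantHom (g := toB6 g Rr H) (fun y : g.Site => y) (fun p : S × ι => blk p.1) Fcs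
      (fun a a' : g.Site => if a = a' then cF * α₁ else 0))
    (h348 : ∀ y y' : g.Site, |B9Thm34Inv.ker (B9Thm34Inv.vol g d) Linv y y'| ≤
      B₁ * g.len y ^ (-(4 : ℝ)) * g.len y' ^ (-(d : ℝ)) * Real.exp (-(δG * g.dist y y')))
    (h348' : ∀ y y' : g.Site, |B9Thm34Inv.ker (B9Thm34Inv.vol g d) Linv' y y'| ≤
      Bc' * g.len y ^ (-(4 : ℝ)) * g.len y' ^ (-(d : ℝ)) * Real.exp (-(δG * g.dist y y')))
    (h366 : HasMajorant (g := toB6 g Rr H) (fun y : g.Site => y) Ccp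
      (fun a a' => κC * α₁ * g.len a ^ 4 * Real.exp (-(δG * g.dist a a'))))
    (hw : ∀ y, 0 ≤ w y) (hcard : ∀ y, ((B9Eq360Vprime.block blk y).card : ℝ) * w y ≤ 1)
    (hkQ : ∀ y x, blk x = y → ‖kQ y x‖ ≤ w y) (hkF : ∀ y x, blk x = y → ‖kF y x‖ ≤ Cq * α₁ * w y)
    (hsQ : ∀ x, ‖sQ x‖ ≤ 1) (hsF : ∀ x, ‖sF x‖ ≤ Cq * α₁) (hcfun : ∀ y, |cfun y| ≤ a₀ * (g.len y ^ 2)⁻¹)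
    (hθ : theta363 (Fintype.card κ) 1 α₁ a₀ Cq M₂ (∑ i, ‖b i‖) (Real.exp (δG * d₀)) BG Λ (B6.c1 d δ₀ β) *
      B6.c1 d ρ₁ α'' < 1)
    (hθL : thetaL363 (Fintype.card κ) 1 α₁ a₀ Cq M₂ (∑ i, ‖b i‖) (Real.exp (δG * d₀)) BG Λ (B6.c1 d δ₀ β) *
      B6.c1 d ρ₁ α'' < 1)
    -- the constant `κ_{P′}` of the (3.77)-step dominates the four explicit (3.68)-constants of `B9Ineq368Vprime`
    (hK1 : kappa368 κQ cF
        (kappa385 1 (cVConc (Fintype.card κ) 1 α₁ a₀ Cq M₂ (∑ i, ‖b i‖) (Real.exp (δG * d₀))) 0 0 Λ (B6.c1 d δ₀ β))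
        κC BG BG (BG * B6.c1 d ρ₁ α'' *
          (1 - theta363 (Fintype.card κ) 1 α₁ a₀ Cq M₂ (∑ i, ‖b i‖) (Real.exp (δG * d₀)) BG Λ (B6.c1 d δ₀ β) * B6.c1 d ρ₁ α'')⁻¹)
        B₁ Bc' Λ (B6.c1 d δ₀ β) α₁ ≤ κP')
    (hK3 : Fintype.card κ * kappa368Ds κQ cF
        (kappa385 BG (cVConc (Fintype.card κ) 1 α₁ a₀ Cq M₂ (∑ i, ‖b i‖) (Real.exp (δG * d₀))) 0 0 Λ (B6.c1 d δ₀ β))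
        κC BG BG BG (B6.c1 d ρ₁ α'' *
          (1 - theta363 (Fintype.card κ) 1 α₁ a₀ Cq M₂ (∑ i, ‖b i‖) (Real.exp (δG * d₀)) BG Λ (B6.c1 d δ₀ β) * B6.c1 d ρ₁ α'')⁻¹)
        (BG * Λρ₁ ^ 2 * B6.c1 d ρ₁ α'' *
          (1 - thetaL363 (Fintype.card κ) 1 α₁ a₀ Cq M₂ (∑ i, ‖b i‖) (Real.exp (δG * d₀)) BG Λ (B6.c1 d δ₀ β) * B6.c1 d ρ₁ α'')⁻¹)
        B₁ Bc' (cBConc (Fintype.card κ) M₂ (∑ i, ‖b i‖) (Real.exp (B9Ineq368Vprime.rateC α'' ρ₁ * d₀)))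
        (cCConc (Fintype.card κ) 1 α₁ a₀ Cq M₂ (∑ i, ‖b i‖) (Real.exp (B9Ineq368Vprime.rateC α'' ρ₁ * d₀))) Λ (B6.c1 d δ₀ β) α₁
        ≤ κP') :
    HasMajorant (g := toB6 g Rr H) (fun p : S × ι => blk p.1) (Gp ∘ₗ Qcs ∘ₗ Linv ∘ₗ Qc ∘ₗ Gp)
      (fun a a' => κP * Real.exp (-(δP * g.dist a a'))) ∧
    HasMajorantHom (g := toB6 g Rr H) (fun p : S × ι => blk p.1) (fun q : (κ × S) × ι => blk q.1.2)
      (conjHom b (gradLin T ((g.eta : ℂ)⁻¹) U) ∘ₗ (Gp ∘ₗ Qcs ∘ₗ Linv ∘ₗ Qc ∘ₗ Gp))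
      (fun a a' => κP * (g.len a)⁻¹ * Real.exp (-(δP * g.dist a a'))) ∧
    HasMajorantHom (g := toB6 g Rr H) (fun q : (κ × S) × ι => blk q.1.2) (fun p : S × ι => blk p.1)
      ((Gp ∘ₗ Qcs ∘ₗ Linv ∘ₗ Qc ∘ₗ Gp) ∘ₗ conjHom b (divLin T ((g.eta : ℂ)⁻¹) U))
      (fun a a' => κP * (g.len a)⁻¹ * Real.exp (-(δP * g.dist a a'))) ∧
    HasMajorant (g := toB6 g Rr H) (fun q : (κ × S) × ι => blk q.1.2)
      (conjHom b (gradLin T ((g.eta : ℂ)⁻¹) U) ∘ₗ (Gp ∘ₗ Qcs ∘ₗ Linv ∘ₗ Qc ∘ₗ Gp) ∘ₗ conjHom b (divLin T ((g.eta : ℂ)⁻¹) U))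
      (fun a a' => κP * (g.len a ^ 2)⁻¹ * Real.exp (-(δP * g.dist a a'))) ∧
    HasMajorant (g := toB6 g Rr H) (fun p : S × ι => blk p.1) (B9Eq360Vprime.pPrime Gp (gPrimeExtEnd Gp (conj b (vPrimeConc T U g.eta A blk kQ kF sQ sF cfun) * Gp)) (Qcs ∘ₗ secRes rep) (Qcs' ∘ₗ secRes rep) (secConj rep Linv) (secConj rep Linv') (secExt rep ∘ₗ Qc) (secExt rep ∘ₗ Qc'))
      (fun a a' => κP' * α₁ * Real.exp (-(δP * g.dist a a'))) ∧
    HasMajorantHom (g := toB6 g Rr H) (fun p : S × ι => blk p.1) (fun q : (κ × S) × ι => blk q.1.2)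
      (conjHom b (gradLin T ((g.eta : ℂ)⁻¹) U) ∘ₗ (B9Eq360Vprime.pPrime Gp (gPrimeExtEnd Gp (conj b (vPrimeConc T U g.eta A blk kQ kF sQ sF cfun) * Gp)) (Qcs ∘ₗ secRes rep) (Qcs' ∘ₗ secRes rep) (secConj rep Linv) (secConj rep Linv') (secExt rep ∘ₗ Qc) (secExt rep ∘ₗ Qc')))
      (fun a a' => κP' * α₁ * (g.len a)⁻¹ * Real.exp (-(δP * g.dist a a'))) ∧
    HasMajorantHom (g := toB6 g Rr H) (fun q : (κ × S) × ι => blk q.1.2) (fun p : S × ι => blk p.1)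
      ((B9Eq360Vprime.pPrime Gp (gPrimeExtEnd Gp (conj b (vPrimeConc T U g.eta A blk kQ kF sQ sF cfun) * Gp)) (Qcs ∘ₗ secRes rep) (Qcs' ∘ₗ secRes rep) (secConj rep Linv) (secConj rep Linv') (secExt rep ∘ₗ Qc) (secExt rep ∘ₗ Qc')) ∘ₗ conjHom b (divLin T ((g.eta : ℂ)⁻¹) U))
      (fun a a' => κP' * α₁ * (g.len a)⁻¹ * Real.exp (-(δP * g.dist a a'))) ∧
    HasMajorant (g := toB6 g Rr H) (fun q : (κ × S) × ι => blk q.1.2)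
      (conjHom b (gradLin T ((g.eta : ℂ)⁻¹) U) ∘ₗ (B9Eq360Vprime.pPrime Gp (gPrimeExtEnd Gp (conj b (vPrimeConc T U g.eta A blk kQ kF sQ sF cfun) * Gp)) (Qcs ∘ₗ secRes rep) (Qcs' ∘ₗ secRes rep) (secConj rep Linv) (secConj rep Linv') (secExt rep ∘ₗ Qc) (secExt rep ∘ₗ Qc')) ∘ₗ conjHom b (divLin T ((g.eta : ℂ)⁻¹) U))
      (fun a a' => κP' * α₁ * (g.len a ^ 2)⁻¹ * Real.exp (-(δP * g.dist a a'))) := by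
  -- the section is injective; its block-compatibility in the shape FILE 17 reads
  have hinj : Function.Injective rep := fun y₁ y₂ h => by rw [← hrep y₁, ← hrep y₂, h]
  have hrep' : ∀ y : g.Site, (fun p : S × ι => blk p.1) (rep y) = (fun y : g.Site => y) y := hrep
  have hKQ : ∀ a a' : g.Site, 0 ≤ (if a = a' then κQ else 0) := fun a a' => by
    split_ifs
    · exact hκQ
    · exact le_rfl
  have hKF : ∀ a a' : g.Site, 0 ≤ (if a = a' then cF * α₁ else 0) := fun a a' => by
    split_ifs
    · exact mul_nonneg hcF hα₁
    · exact le_rfl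
  -- the coarse-lattice letters read on the sites (FILE 17): the hypotheses `hQp … hCp`, `h357p`, `h357ps`, `hCC` of FILES 15/16
  have hQp : HasMajorant (g := toB6 g Rr H) (fun p : S × ι => blk p.1) (secExt rep ∘ₗ Qc)
      (fun a a' : g.Site => if a = a' then κQ else 0) :=
    hasMajorant_secExt_comp (g := toB6 g Rr H) (blkX := fun p : S × ι => blk p.1) (blkZ := fun y : g.Site => y) hrep' hKQ hQc
  have hQps : HasMajorant (g := toB6 g Rr H) (fun p : S × ι => blk p.1) (Qcs ∘ₗ secRes rep)
      (fun a a' : g.Site => if a = a' then κQ else 0) :=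
    hasMajorant_comp_secRes (g := toB6 g Rr H) (blkX := fun p : S × ι => blk p.1) (blkZ := fun y : g.Site => y) hrep' hQcs
  have hFp : HasMajorant (g := toB6 g Rr H) (fun p : S × ι => blk p.1) (secExt rep ∘ₗ Fc)
      (fun a a' : g.Site => if a = a' then cF * α₁ else 0) :=
    hasMajorant_secExt_comp (g := toB6 g Rr H) (blkX := fun p : S × ι => blk p.1) (blkZ := fun y : g.Site => y) hrep' hKF hFc
  have hFps : HasMajorant (g := toB6 g Rr H) (fun p : S × ι => blk p.1) (Fcs ∘ₗ secRes rep)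
      (fun a a' : g.Site => if a = a' then cF * α₁ else 0) :=
    hasMajorant_comp_secRes (g := toB6 g Rr H) (blkX := fun p : S × ι => blk p.1) (blkZ := fun y : g.Site => y) hrep' hFcs
  have h357p : secExt rep ∘ₗ Qc' = secExt rep ∘ₗ Qc + secExt rep ∘ₗ Fc := by rw [h357, secExt_comp_add]
  have h357ps : Qcs' ∘ₗ secRes rep = Qcs ∘ₗ secRes rep + Fcs ∘ₗ secRes rep := by rw [h357s, add_comp_secRes]
  have hCC : secConj rep Linv' - secConj rep Linv = -(secConj rep Linv' * secConj rep Ccp * secConj rep Linv) :=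
    secConj_resolvent hinj h367
  have hw4 : ∀ y : g.Site, g.len y ^ (-(4 : ℝ)) = (g.len y ^ 4)⁻¹ := fun y => by
    rw [Real.rpow_neg (hlen y).le, show (4 : ℝ) = ((4 : ℕ) : ℝ) by norm_num, Real.rpow_natCast]
  have hCinv : HasMajorant (g := toB6 g Rr H) (fun p : S × ι => blk p.1) (secConj rep Linv)
      (fun a a' => B₁ * (g.len a ^ 4)⁻¹ * Real.exp (-(δG * g.dist a a'))) := by
    have h := hasMajorant_sites_of_ker (R := Rr) (H := H) (fun p : S × ι => blk p.1) hrep d hlen B₁ (fun y => g.len y ^ (-(4 : ℝ)))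
      (fun y y' => Real.exp (-(δG * g.dist y y')))
      (fun y y' => mul_nonneg (mul_nonneg hB₁ (Real.rpow_nonneg (hlen y).le _)) (Real.exp_nonneg _)) h348
    exact hasMajorant_mono (g := toB6 g Rr H) _ h fun a a' => by rw [hw4 a]
  have hCinv' : HasMajorant (g := toB6 g Rr H) (fun p : S × ι => blk p.1) (secConj rep Linv')
      (fun a a' => Bc' * (g.len a ^ 4)⁻¹ * Real.exp (-(δG * g.dist a a'))) := by
    have h := hasMajorant_sites_of_ker (R := Rr) (H := H) (fun p : S × ι => blk p.1) hrep d hlen Bc' (fun y => g.len y ^ (-(4 : ℝ)))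
      (fun y y' => Real.exp (-(δG * g.dist y y')))
      (fun y y' => mul_nonneg (mul_nonneg hBc' (Real.rpow_nonneg (hlen y).le _)) (Real.exp_nonneg _)) h348'
    exact hasMajorant_mono (g := toB6 g Rr H) _ h fun a a' => by rw [hw4 a]
  have hCp : HasMajorant (g := toB6 g Rr H) (fun p : S × ι => blk p.1) (secConj rep Ccp)
      (fun a a' => κC * α₁ * g.len a ^ 4 * Real.exp (-(δG * g.dist a a'))) :=
    hasMajorant_secConj (g := toB6 g Rr H) (blkX := fun p : S × ι => blk p.1) (blkZ := fun y : g.Site => y) hrep'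
      (fun a a' => mul_nonneg (mul_nonneg (mul_nonneg hκC hα₁) (pow_nonneg (hlen a).le 4)) (Real.exp_nonneg _)) h366
  -- the word of `P(U)` through the section IS `G′Q′*C⁻¹Q′G′` (FILE 17 `word_secConj`, here pointwise for this bracketing)
  have hPw : (Gp ∘ₗ (Qcs ∘ₗ secRes rep) ∘ₗ secConj rep Linv ∘ₗ (secExt rep ∘ₗ Qc) ∘ₗ Gp) = (Gp ∘ₗ Qcs ∘ₗ Linv ∘ₗ Qc ∘ₗ Gp) :=
    LinearMap.ext fun F => by simp only [LinearMap.comp_apply, secConj_def, secRes_secExt_apply hinj]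
  have h := hasMajorant_pPrime_site (Rr := Rr) (H := H) b T U blk d δ₀ δP δG α β ρ₁ α'' Λ Λρ₁ κQ BG B₁ Bc' κC cF Cq a₀ κP κP' α₁ d₀ M₂
    kQ kF sQ sF cfun w hκQ hBG hB₁ hBc' hκC hcF hCq ha₀ hα₁ hΛ hα hβ hδ₀ hδP0 hM₂ hrG hr1 hα''1 hα''0 hρ₁ hα''ρ hα''ρ2 hα''ρ3 hΛρ₁
    hr368 hκP hdnn htri hrefl hsym hlen h261 h261'' hT1 hT2 hT1i hT2i hT4 hTρ₁ hrepr hη A hsmall hU1 h337B h337F h337Bτ hA hAτB hd₀B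
    hd₀F hd₀0 h342_1 h342_2 h342_3 h357p h357ps hCC hQp hQps hFp hFps hCinv hCinv' hCp hw hcard hkQ hkF hsQ hsF hcfun hθ hθL hK1 hK3
  rw [hPw] at h
  exact h

end PPrime

/-! ## §2  «The inverse satisfies Theorem 3.2» and the eight entries for the `P′(A)` built with `C⁻¹(U′U)` -/

section CInv

variable {𝔸 : Type*} [NormedRing 𝔸] [NormedAlgebra ℂ 𝔸] [CompleteSpace 𝔸] {ι : Type} [Fintype ι]
variable (b : Module.Basis ι ℝ 𝔸) {S : Type} {κ : Type} [Fintype κ] [LinearOrder κ]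
variable (T : κ → Equiv.Perm S) (U : κ → S → 𝔸ˣ)
variable {g : B9.Geometry} [Fintype g.Site] {Rr : ℝ} {H : Prop}

omit [LinearOrder κ] in
set_option maxHeartbeats 800000 in
/-- **«THE INVERSE SATISFIES THEOREM 3.2» + (3.49) FOR `P(U)` + (3.68) FOR THE CONCRETE `P′(A)`** — FILE 25's `exists_cinv_pOne_concrete` proof
(gen 9 `inverse_satisfies_thm32_vPrime` ⇒ `Tinv = C⁻¹(U′U)` with (3.48) at `(1−α₃)(½−α_v)δ₀ ≧ δ_G`; `hasMajorant_cPrimeHom_vPrime` ⇒ (3.66) at `δ_G`;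
(3.63) ⇒ ‖V′G′‖ < 1 ⇒ (3.65) ⇒ `L′ = L + C′(A)` ⇒ (3.67)), closed by `hasMajorant_pPrime_coarse`: THERE EXISTS `C⁻¹(U′U)`, two-sided inverse of
`Q′(U′U)G′²(U′U)Q′*(U′U)` on 𝔅, AND the eight entries hold for `P(U)` and for the `P′(A)` built with it.
[cite: Balaban1985BackgroundPropagators, (3.49) p.399 + (3.68) p.403 + (3.25) p.394 + (3.19) p.393 + (3.57) p.401 + (3.59) p.402 + (3.65)–(3.67) pp.402–403 + Thm 3.1 (3.42) p.397 + Thm 3.2 (3.48) p.398 + (3.37) p.396 + Thm 3.4 p.400; Balaban1984PropagatorsII, Lemma 2.1 p.234 + (2.51)–(2.55) p.232 + (2.66) p.234; Balaban1985Variational, (135) p.298] -/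
theorem exists_cinv_pPrime_concrete [Fintype S] [DecidableEq S] [DecidableEq ι] [DecidableEq g.Site] (blk : S → g.Site) (d : ℕ)
    (δ₀ δP δG δ1 ρc αc αv α₃ c₄ α β ρ₁ α'' Λ Λρ₁ κQ BG B₁ Bc' κC cF Cq a₀ κP κP' α₁ d₀ M₂ : ℝ)
    (kQ kF : g.Site → S → 𝔸 →L[ℝ] 𝔸) (sQ sF : S → 𝔸 →L[ℝ] 𝔸) (cfun w : g.Site → ℝ)
    (hκQ : 0 < κQ) (hBG : 0 < BG) (hB₁ : 0 < B₁) (hcF : 0 < cF) (hCq : 0 ≤ Cq) (ha₀ : 0 ≤ a₀) (hα₁ : 0 ≤ α₁) (hΛ : 1 ≤ Λ)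
    (hα : 0 ≤ α) (hβ : 0 ≤ β) (hδ₀ : 0 < δ₀) (hδP0 : 0 ≤ δP) (hM₂ : 0 ≤ M₂)
    (hrG : δP + (2 * α + β) * δ₀ ≤ δG)
    (hr1 : ρ₁ + (α + β) * δ₀ ≤ δG) (hα''1 : α'' ≤ 1) (hα''0 : 0 ≤ α'') (hρ₁ : 0 ≤ ρ₁) (hα''ρ : 0 ≤ (1 - α'') * ρ₁)
    (hα''ρ2 : 0 ≤ (1 - 2 * α'') * ρ₁) (hα''ρ3 : 0 ≤ (1 - 3 * α'') * ρ₁) (hΛρ₁ : 0 ≤ Λρ₁)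
    (hr368 : δP + 2 * ((2 * α + β) * δ₀) ≤ B9Ineq368Vprime.rateC α'' ρ₁)
    -- the (Q′G′²Q′*)⁻¹-clause chain has its own rates (FILE 19)
    (hrc1 : ρc + (α + β) * δ₀ ≤ δ1) (hρc : 0 ≤ ρc) (hαc0 : 0 ≤ αc) (hαc1 : αc ≤ 1)
    (hrc : δ₀ / 2 + (α + β) * δ₀ ≤ (1 - αc) * ρc) (hrcG : δG + (α + β) * δ₀ ≤ (1 - αc) * ρc) (hGδ1 : δG ≤ δ1) (hGδ₀ : δG ≤ δ₀)
    (hαv0 : 0 < αv) (hαv : αv < 1 / 2) (hα₃ : α₃ < 1) (hc₄ : 0 < c₄) (hrCinv : δG ≤ (1 - α₃) * ((1 / 2 - αv) * δ₀))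
    (hc₁v : 0 < B6.c1 d δ₀ (1 / 2 + αv)) (hc₁v' : 0 < B6.c1 d ((1 / 2 - αv) * δ₀) α₃) (hc₂ : 0 < B6.c1 d δ₀ β)
    (hcc' : 0 < B6.c1 d ρc αc)
    (hκC : κC = kappa366 κQ cF
      (kappa385 1 (cVConc (Fintype.card κ) 1 α₁ a₀ Cq M₂ (∑ i, ‖b i‖) (Real.exp (δ1 * d₀))) 0 0 Λ (B6.c1 d δ₀ β)) BG
      (BG * B6.c1 d ρc αc *
        (1 - theta363 (Fintype.card κ) 1 α₁ a₀ Cq M₂ (∑ i, ‖b i‖) (Real.exp (δ1 * d₀)) BG Λ (B6.c1 d δ₀ β) * B6.c1 d ρc αc)⁻¹)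
      Λ (B6.c1 d δ₀ β) α₁)
    (hBc' : Bc' = 2 * B₁ * B6.c1 d ((1 / 2 - αv) * δ₀) α₃)
    (ha₁ : α₁ ≤ (2 * (κC * B₁ * c₄ * B6.c1 d δ₀ (1 / 2 + αv)) * B6.c1 d ((1 / 2 - αv) * δ₀) α₃)⁻¹)
    (hκP : κP = kappa349 κQ ((1 + Fintype.card κ) * BG) B₁ Λ (B6.c1 d δ₀ β))
    (hdnn : ∀ a a' : g.Site, 0 ≤ g.dist a a') (htri : Triangle254 (toB6 g Rr H)) (hrefl : ∀ y : g.Site, g.dist y y = 0)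
    (hsym : ∀ y y' : g.Site, g.dist y y' = g.dist y' y) (hlen : ∀ y : g.Site, 0 < g.len y)
    (h261 : Ineq261 d (toB6 g Rr H) δ₀ β) (h261'' : Ineq261 d (toB6 g Rr H) ρ₁ α'')
    (h261c : Ineq261 d (toB6 g Rr H) ρc αc) (h261v : Ineq261 d (toB6 g Rr H) δ₀ (1 / 2 + αv))
    (h261v' : Ineq261 d (toB6 g Rr H) ((1 / 2 - αv) * δ₀) α₃)
    (hT1 : ScaleTransfer g δ₀ α Λ (fun a => g.len a)) (hT2 : ScaleTransfer g δ₀ α Λ (fun a => g.len a ^ 2))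
    (hT1i : ScaleTransfer g δ₀ α Λ (fun a => (g.len a)⁻¹)) (hT2i : ScaleTransfer g δ₀ α Λ (fun a => (g.len a ^ 2)⁻¹))
    (hT4 : ScaleTransfer g δ₀ α Λ (fun a => (g.len a ^ 4)⁻¹))
    (hTρ₁ : ScaleTransfer g ρ₁ α'' Λρ₁ (fun a => g.len a)) (hT4v : ScaleTransfer g δ₀ αv c₄ (fun y => g.len y ^ (-(4 : ℝ))))
    (hrepr : ∀ (v : 𝔸) (i : ι), |b.repr v i| ≤ M₂ * ‖v‖) (hη : 0 < g.eta) (A : κ → S → 𝔸)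
    (hsmall : ∀ y : g.Site, g.eta * (α₁ * (g.len y)⁻¹) ≤ 1 / 4)
    (hU1 : ∀ m z, ‖((U m z : 𝔸ˣ) : 𝔸)‖ ≤ 1 ∧ ‖(((U m z)⁻¹ : 𝔸ˣ) : 𝔸)‖ ≤ 1)
    -- (3.37) for the exponent field, blockwise
    (h337B : ∀ ν k x, ‖((g.eta : ℂ)⁻¹) • covDstar T U ν (A k) x‖ ≤ α₁ * (g.len (blk x) ^ 2)⁻¹)
    (h337F : ∀ μ ν x, ‖((g.eta : ℂ)⁻¹) • covD T U μ (A ν) x‖ ≤ α₁ * (g.len (blk x) ^ 2)⁻¹)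
    (h337Bτ : ∀ μ x, ‖((g.eta : ℂ)⁻¹) • covDstar T U μ (tauB T U μ (A μ)) x‖ ≤ α₁ * (g.len (blk x) ^ 2)⁻¹)
    (hA : ∀ k x, ‖A k x‖ ≤ α₁ * (g.len (blk x))⁻¹) (hAτB : ∀ ν k x, ‖tauB T U ν (A k) x‖ ≤ α₁ * (g.len (blk x))⁻¹)
    -- stencil geometry
    (hd₀B : ∀ μ x, g.dist (blk x) (blk ((T μ).symm x)) ≤ d₀) (hd₀F : ∀ μ x, g.dist (blk x) (blk (T μ x)) ≤ d₀)
    (hd₀0 : ∀ y : g.Site, g.dist y y ≤ d₀)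
    -- Theorem 3.1 (3.42)₁,₂,₃ for `G′(U)` at the rate `δ1`
    {Gp : Module.End ℝ (S × ι → ℝ)}
    (h342_1 : HasMajorant (g := toB6 g Rr H) (fun p : S × ι => blk p.1) Gp
      (fun a a' => BG * g.len a ^ 2 * Real.exp (-(δ1 * g.dist a a'))))
    (h342_2 : ∀ k : κ ⊕ κ, HasMajorant (g := toB6 g Rr H) (fun p : S × ι => blk p.1)
      (conj b (diffLetter T U ((g.eta : ℂ)⁻¹) k) * Gp) (fun a a' => BG * g.len a * Real.exp (-(δ1 * g.dist a a'))))
    (h342_3 : ∀ k : κ ⊕ κ, HasMajorant (g := toB6 g Rr H) (fun p : S × ι => blk p.1)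
      (Gp * conj b (diffLetter T U ((g.eta : ℂ)⁻¹) k)) (fun a a' => BG * g.len a * Real.exp (-(δ1 * g.dist a a'))))
    -- the coarse-lattice letters in their own typing and Theorem 3.2 for `U` (FILE 19's block)
    (rep : g.Site → S × ι) (hrep : ∀ y : g.Site, blk (rep y).1 = y)
    {Qc Qc' Fc : (S × ι → ℝ) →ₗ[ℝ] (g.Site → ℝ)} {Qcs Qcs' Fcs : (g.Site → ℝ) →ₗ[ℝ] (S × ι → ℝ)}
    {Linv : Module.End ℝ (g.Site → ℝ)}
    (h357 : Qc' = Qc + Fc) (h357s : Qcs' = Qcs + Fcs)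
    (hQc : HasMajorantHom (g := toB6 g Rr H) (fun p : S × ι => blk p.1) (fun y : g.Site => y) Qc
      (fun a a' : g.Site => κQ * (if a = a' then (1 : ℝ) else 0)))
    (hQcs : HasMajorantHom (g := toB6 g Rr H) (fun y : g.Site => y) (fun p : S × ι => blk p.1) Qcs
      (fun a a' : g.Site => κQ * (if a = a' then (1 : ℝ) else 0)))
    (hFc : HasMajorantHom (g := toB6 g Rr H) (fun p : S × ι => blk p.1) (fun y : g.Site => y) Fc
      (fun a a' : g.Site => cF * α₁ * (if a = a' then (1 : ℝ) else 0)))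
    (hFcs : HasMajorantHom (g := toB6 g Rr H) (fun y : g.Site => y) (fun p : S × ι => blk p.1) Fcs
      (fun a a' : g.Site => cF * α₁ * (if a = a' then (1 : ℝ) else 0)))
    (hLinv : (Qc ∘ₗ (Gp * Gp) ∘ₗ Qcs) * Linv = 1)
    (h348 : ∀ y y' : g.Site, |B9Thm34Inv.ker (B9Thm34Inv.vol g d) Linv y y'| ≤
      B₁ * g.len y ^ (-(4 : ℝ)) * g.len y' ^ (-(d : ℝ)) * Real.exp (-(δ₀ * g.dist y y')))
    (hθc : theta363 (Fintype.card κ) 1 α₁ a₀ Cq M₂ (∑ i, ‖b i‖) (Real.exp (δ1 * d₀)) BG Λ (B6.c1 d δ₀ β) *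
      B6.c1 d ρc αc < 1)
    -- the data of the CONCRETE `V′(A)` of (3.60) and the smallness/constant conditions of `B9Ineq363Vprime`/`B9Ineq368Vprime`
    (hw : ∀ y, 0 ≤ w y) (hcard : ∀ y, ((B9Eq360Vprime.block blk y).card : ℝ) * w y ≤ 1)
    (hkQ : ∀ y x, blk x = y → ‖kQ y x‖ ≤ w y) (hkF : ∀ y x, blk x = y → ‖kF y x‖ ≤ Cq * α₁ * w y)
    (hsQ : ∀ x, ‖sQ x‖ ≤ 1) (hsF : ∀ x, ‖sF x‖ ≤ Cq * α₁) (hcfun : ∀ y, |cfun y| ≤ a₀ * (g.len y ^ 2)⁻¹)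
    (hθ : theta363 (Fintype.card κ) 1 α₁ a₀ Cq M₂ (∑ i, ‖b i‖) (Real.exp (δG * d₀)) BG Λ (B6.c1 d δ₀ β) *
      B6.c1 d ρ₁ α'' < 1)
    (hθL : thetaL363 (Fintype.card κ) 1 α₁ a₀ Cq M₂ (∑ i, ‖b i‖) (Real.exp (δG * d₀)) BG Λ (B6.c1 d δ₀ β) *
      B6.c1 d ρ₁ α'' < 1)
    -- the constant `κ_{P′}` of the (3.77)-step dominates the four explicit (3.68)-constants of `B9Ineq368Vprime`
    (hK1 : kappa368 κQ cF
        (kappa385 1 (cVConc (Fintype.card κ) 1 α₁ a₀ Cq M₂ (∑ i, ‖b i‖) (Real.exp (δG * d₀))) 0 0 Λ (B6.c1 d δ₀ β))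
        κC BG BG (BG * B6.c1 d ρ₁ α'' *
          (1 - theta363 (Fintype.card κ) 1 α₁ a₀ Cq M₂ (∑ i, ‖b i‖) (Real.exp (δG * d₀)) BG Λ (B6.c1 d δ₀ β) * B6.c1 d ρ₁ α'')⁻¹)
        B₁ Bc' Λ (B6.c1 d δ₀ β) α₁ ≤ κP')
    (hK3 : Fintype.card κ * kappa368Ds κQ cF
        (kappa385 BG (cVConc (Fintype.card κ) 1 α₁ a₀ Cq M₂ (∑ i, ‖b i‖) (Real.exp (δG * d₀))) 0 0 Λ (B6.c1 d δ₀ β))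
        κC BG BG BG (B6.c1 d ρ₁ α'' *
          (1 - theta363 (Fintype.card κ) 1 α₁ a₀ Cq M₂ (∑ i, ‖b i‖) (Real.exp (δG * d₀)) BG Λ (B6.c1 d δ₀ β) * B6.c1 d ρ₁ α'')⁻¹)
        (BG * Λρ₁ ^ 2 * B6.c1 d ρ₁ α'' *
          (1 - thetaL363 (Fintype.card κ) 1 α₁ a₀ Cq M₂ (∑ i, ‖b i‖) (Real.exp (δG * d₀)) BG Λ (B6.c1 d δ₀ β) * B6.c1 d ρ₁ α'')⁻¹)
        B₁ Bc' (cBConc (Fintype.card κ) M₂ (∑ i, ‖b i‖) (Real.exp (B9Ineq368Vprime.rateC α'' ρ₁ * d₀)))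
        (cCConc (Fintype.card κ) 1 α₁ a₀ Cq M₂ (∑ i, ‖b i‖) (Real.exp (B9Ineq368Vprime.rateC α'' ρ₁ * d₀))) Λ (B6.c1 d δ₀ β) α₁
        ≤ κP') :
    ∃ Tinv : Module.End ℝ (g.Site → ℝ),
      Tinv * (Qc' ∘ₗ ((gPrimeExtEnd Gp (conj b (vPrimeConc T U g.eta A blk kQ kF sQ sF cfun) * Gp)) * (gPrimeExtEnd Gp (conj b (vPrimeConc T U g.eta A blk kQ kF sQ sF cfun) * Gp))) ∘ₗ Qcs') = 1 ∧
      (Qc' ∘ₗ ((gPrimeExtEnd Gp (conj b (vPrimeConc T U g.eta A blk kQ kF sQ sF cfun) * Gp)) * (gPrimeExtEnd Gp (conj b (vPrimeConc T U g.eta A blk kQ kF sQ sF cfun) * Gp))) ∘ₗ Qcs') * Tinv = 1 ∧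
      HasMajorant (g := toB6 g Rr H) (fun p : S × ι => blk p.1) (Gp ∘ₗ Qcs ∘ₗ Linv ∘ₗ Qc ∘ₗ Gp)
        (fun a a' => κP * Real.exp (-(δP * g.dist a a'))) ∧
      HasMajorantHom (g := toB6 g Rr H) (fun p : S × ι => blk p.1) (fun q : (κ × S) × ι => blk q.1.2)
        (conjHom b (gradLin T ((g.eta : ℂ)⁻¹) U) ∘ₗ (Gp ∘ₗ Qcs ∘ₗ Linv ∘ₗ Qc ∘ₗ Gp))
        (fun a a' => κP * (g.len a)⁻¹ * Real.exp (-(δP * g.dist a a'))) ∧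
      HasMajorantHom (g := toB6 g Rr H) (fun q : (κ × S) × ι => blk q.1.2) (fun p : S × ι => blk p.1)
        ((Gp ∘ₗ Qcs ∘ₗ Linv ∘ₗ Qc ∘ₗ Gp) ∘ₗ conjHom b (divLin T ((g.eta : ℂ)⁻¹) U))
        (fun a a' => κP * (g.len a)⁻¹ * Real.exp (-(δP * g.dist a a'))) ∧
      HasMajorant (g := toB6 g Rr H) (fun q : (κ × S) × ι => blk q.1.2)
        (conjHom b (gradLin T ((g.eta : ℂ)⁻¹) U) ∘ₗ (Gp ∘ₗ Qcs ∘ₗ Linv ∘ₗ Qc ∘ₗ Gp) ∘ₗ conjHom b (divLin T ((g.eta : ℂ)⁻¹) U))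
        (fun a a' => κP * (g.len a ^ 2)⁻¹ * Real.exp (-(δP * g.dist a a'))) ∧
      HasMajorant (g := toB6 g Rr H) (fun p : S × ι => blk p.1) (B9Eq360Vprime.pPrime Gp (gPrimeExtEnd Gp (conj b (vPrimeConc T U g.eta A blk kQ kF sQ sF cfun) * Gp)) (Qcs ∘ₗ secRes rep) (Qcs' ∘ₗ secRes rep) (secConj rep Linv) (secConj rep Tinv) (secExt rep ∘ₗ Qc) (secExt rep ∘ₗ Qc'))
        (fun a a' => κP' * α₁ * Real.exp (-(δP * g.dist a a'))) ∧
      HasMajorantHom (g := toB6 g Rr H) (fun p : S × ι => blk p.1) (fun q : (κ × S) × ι => blk q.1.2)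
        (conjHom b (gradLin T ((g.eta : ℂ)⁻¹) U) ∘ₗ (B9Eq360Vprime.pPrime Gp (gPrimeExtEnd Gp (conj b (vPrimeConc T U g.eta A blk kQ kF sQ sF cfun) * Gp)) (Qcs ∘ₗ secRes rep) (Qcs' ∘ₗ secRes rep) (secConj rep Linv) (secConj rep Tinv) (secExt rep ∘ₗ Qc) (secExt rep ∘ₗ Qc')))
        (fun a a' => κP' * α₁ * (g.len a)⁻¹ * Real.exp (-(δP * g.dist a a'))) ∧
      HasMajorantHom (g := toB6 g Rr H) (fun q : (κ × S) × ι => blk q.1.2) (fun p : S × ι => blk p.1)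
        ((B9Eq360Vprime.pPrime Gp (gPrimeExtEnd Gp (conj b (vPrimeConc T U g.eta A blk kQ kF sQ sF cfun) * Gp)) (Qcs ∘ₗ secRes rep) (Qcs' ∘ₗ secRes rep) (secConj rep Linv) (secConj rep Tinv) (secExt rep ∘ₗ Qc) (secExt rep ∘ₗ Qc')) ∘ₗ conjHom b (divLin T ((g.eta : ℂ)⁻¹) U))
        (fun a a' => κP' * α₁ * (g.len a)⁻¹ * Real.exp (-(δP * g.dist a a'))) ∧
      HasMajorant (g := toB6 g Rr H) (fun q : (κ × S) × ι => blk q.1.2)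
        (conjHom b (gradLin T ((g.eta : ℂ)⁻¹) U) ∘ₗ (B9Eq360Vprime.pPrime Gp (gPrimeExtEnd Gp (conj b (vPrimeConc T U g.eta A blk kQ kF sQ sF cfun) * Gp)) (Qcs ∘ₗ secRes rep) (Qcs' ∘ₗ secRes rep) (secConj rep Linv) (secConj rep Tinv) (secExt rep ∘ₗ Qc) (secExt rep ∘ₗ Qc')) ∘ₗ conjHom b (divLin T ((g.eta : ℂ)⁻¹) U))
        (fun a a' => κP' * α₁ * (g.len a ^ 2)⁻¹ * Real.exp (-(δP * g.dist a a'))) := by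
  -- signs, rates, the block-diagonal majorants in FILE 18's `if … then κ else 0` form
  have hSb : 0 ≤ ∑ i, ‖b i‖ := Finset.sum_nonneg fun i _ => norm_nonneg _
  have hΛ0 : 0 < Λ := zero_lt_one.trans_le hΛ
  have hαβ : 0 ≤ (α + β) * δ₀ := mul_nonneg (add_nonneg hα hβ) hδ₀.le
  have h2αβ : 0 ≤ (2 * α + β) * δ₀ := mul_nonneg (add_nonneg (mul_nonneg zero_le_two hα) hβ) hδ₀.le
  have hδG0 : 0 ≤ δG := le_trans (le_trans hδP0 (le_add_of_nonneg_right h2αβ)) hrG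
  have hδ1_0 : 0 ≤ δ1 := le_trans (add_nonneg hρc hαβ) hrc1
  have hαcρ : 0 ≤ (1 - αc) * ρc := mul_nonneg (sub_nonneg.mpr hαc1) hρc
  have hcV0 : 0 ≤ kappa385 1 (cVConc (Fintype.card κ) 1 α₁ a₀ Cq M₂ (∑ i, ‖b i‖) (Real.exp (δ1 * d₀))) 0 0 Λ (B6.c1 d δ₀ β) :=
    kappa385_nonneg zero_le_one (cVConc_nonneg hα₁ ha₀ hCq hM₂ hSb (Real.exp_nonneg _)) le_rfl le_rfl hΛ0.le
      (B6RandomWalk.c1_nonneg d δ₀ β)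
  have hθc0 : 0 ≤ theta363 (Fintype.card κ) 1 α₁ a₀ Cq M₂ (∑ i, ‖b i‖) (Real.exp (δ1 * d₀)) BG Λ (B6.c1 d δ₀ β) :=
    theta363_nonneg hα₁ ha₀ hCq hM₂ hSb (Real.exp_nonneg _) hBG.le hΛ0.le (B6RandomWalk.c1_nonneg d δ₀ β)
  have hB₁' : 0 < BG * B6.c1 d ρc αc *
      (1 - theta363 (Fintype.card κ) 1 α₁ a₀ Cq M₂ (∑ i, ‖b i‖) (Real.exp (δ1 * d₀)) BG Λ (B6.c1 d δ₀ β) * B6.c1 d ρc αc)⁻¹ :=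
    mul_pos (mul_pos hBG hcc') (inv_pos.mpr (by linarith))
  have hκC0 : 0 ≤ κC := by
    rw [hκC]; exact (kappa366_pos hκQ hcF hcV0 hB₁' hΛ0 hc₂ hα₁).le
  have hBc0 : 0 ≤ Bc' := by
    rw [hBc']; exact mul_nonneg (mul_nonneg zero_le_two hB₁.le) hc₁v'.le
  have hind : ∀ κ₀ : ℝ, (fun a a' : g.Site => κ₀ * (if a = a' then (1 : ℝ) else 0)) = fun a a' : g.Site => if a = a' then κ₀ else 0 :=
    fun κ₀ => by
      funext a a'
      split_ifs <;> simp
  have hQc' := hQc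
  have hQcs' := hQcs
  have hFc' := hFc
  have hFcs' := hFcs
  rw [hind] at hQc' hQcs' hFc' hFcs'
  have hw1 : ∀ a : g.Site, 0 ≤ g.len a := fun a => (hlen a).le
  have h342_1G : HasMajorant (g := toB6 g Rr H) (fun p : S × ι => blk p.1) Gp
      (fun a a' => BG * g.len a ^ 2 * Real.exp (-(δG * g.dist a a'))) :=
    hasMajorant_rate_mono (R := Rr) (H := H) _ BG (fun a => g.len a ^ 2) hBG.le (fun a => sq_nonneg _) hGδ1 hdnn h342_1
  have h342_2G : ∀ k : κ ⊕ κ, HasMajorant (g := toB6 g Rr H) (fun p : S × ι => blk p.1)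
      (conj b (diffLetter T U ((g.eta : ℂ)⁻¹) k) * Gp) (fun a a' => BG * g.len a * Real.exp (-(δG * g.dist a a'))) := fun k =>
    hasMajorant_rate_mono (R := Rr) (H := H) _ BG (fun a => g.len a) hBG.le hw1 hGδ1 hdnn (h342_2 k)
  have h342_3G : ∀ k : κ ⊕ κ, HasMajorant (g := toB6 g Rr H) (fun p : S × ι => blk p.1)
      (Gp * conj b (diffLetter T U ((g.eta : ℂ)⁻¹) k)) (fun a a' => BG * g.len a * Real.exp (-(δG * g.dist a a'))) := fun k =>
    hasMajorant_rate_mono (R := Rr) (H := H) _ BG (fun a => g.len a) hBG.le hw1 hGδ1 hdnn (h342_3 k)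
  -- the shapes `B9Ineq366Vprime`/`B9Ineq363Vprime` read (3.37)/stencil geometry in
  have hA' : ∀ μ x, ‖A μ x‖ ≤ α₁ * (g.len (blk x))⁻¹ ∧ ‖tauB T U μ (A μ) x‖ ≤ α₁ * (g.len (blk x))⁻¹ :=
    fun μ x => ⟨hA μ x, hAτB μ μ x⟩
  have h337s' : ∀ μ x, ‖((g.eta : ℂ)⁻¹) • covDstar T U μ (A μ) x‖ ≤ α₁ * (g.len (blk x) ^ 2)⁻¹ := fun μ x => h337B μ μ x
  have hd₀' : ∀ μ x, g.dist (blk x) (blk (T μ x)) ≤ d₀ ∧ g.dist (blk x) (blk ((T μ).symm x)) ≤ d₀ :=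
    fun μ x => ⟨hd₀F μ x, hd₀B μ x⟩
  set V := (conj b (vPrimeConc T U g.eta A blk kQ kF sQ sF cfun)) with hVdef
  set E := gPrimeExtEnd Gp (V * Gp) with hEdef
  -- «The inverse satisfies Theorem 3.2»: `C⁻¹(U′U)` for the concrete `V′(A)` and `G′(U′U)` (gen 9), threshold `ha₁`
  have ha₁' := ha₁
  rw [hκC] at ha₁'
  obtain ⟨Tinv, hTl, hTr, hTker⟩ := inverse_satisfies_thm32_vPrime (Rr := Rr) (H := H) b T U blk d hη A kQ kF sQ sF cfun w 1 d₀
    M₂ Cq a₀ δ₀ δ1 α β ρc Λ BG α₁ αc κQ cF αv α₃ c₄ B₁ hBG hα₁ hΛ0 hρc hα hβ hδ₀ hδ1_0 hκQ hcF hαv0 hαv hα₃ hc₄ hB₁ hrc1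
    hαc0 hαc1 hrc hc₁v hc₁v' hc₂ hcc' hdnn hrefl hsym htri hlen h261 h261c h261v h261v' hT1 hT2 hT4v hM₂ hrepr hsmall hA'
    h337s' hU1 hd₀' hd₀0 hw hcard hCq ha₀ hkQ hkF hsQ hsF hcfun hθc h342_1 h342_2 h357 h357s hQc hQcs hFc hFcs hLinv h348 ha₁'
  -- (3.66) for the concrete `C′(A)` delivered at the rate `δ_G` (gen 9)
  have h366G : HasMajorant (g := toB6 g Rr H) (fun y : g.Site => y) (cPrimeHom Qc Fc Qcs Fcs Gp E V)
      (fun a a' => κC * α₁ * g.len a ^ 4 * Real.exp (-(δG * g.dist a a'))) := by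
    rw [hκC]
    exact hasMajorant_cPrimeHom_vPrime (Rr := Rr) (H := H) b T U blk d hη A kQ kF sQ sF cfun w 1 d₀ M₂ Cq a₀ δ₀ δ1 α β ρc
      δG Λ BG α₁ αc κQ cF hBG.le hα₁ hΛ0.le hρc hδG0 hα hβ hδ₀.le hδ1_0 hκQ.le hcF.le hrc1 hαc0 hαc1 hrcG hdnn hrefl htri
      hlen h261 h261c hT1 hT2 hM₂ hrepr hsmall hA' h337s' hU1 hd₀' hd₀0 hw hcard hCq ha₀ hkQ hkF hsQ hsF hcfun hθc h342_1
      h342_2 hQc hQcs hFc hFcs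
  -- (3.63) ⇒ ‖V′G′‖ < 1 ⇒ both forms of (3.65) for `E` ⇒ the p. 403 expansion `L′ = L + C′(A)` ⇒ (3.67) on 𝔅
  have h363 := ineq363_op_vPrime (Rr := Rr) (H := H) b T U blk d hη A kQ kF sQ sF cfun w 1 d₀ M₂ Cq a₀ δ₀ δ1 α β ρc Λ BG
    α₁ hBG.le hα₁ hΛ0.le hρc hα hβ hδ₀.le hδ1_0 hrc1 hdnn htri hlen h261 hT1 hT2 hM₂ hrepr hsmall hA' h337s' hU1 hd₀' hd₀0 hw
    hcard hCq ha₀ hkQ hkF hsQ hsF hcfun h342_1 h342_2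
  have hW : ‖B9Eq360Vprime.toCLM (V * Gp)‖ < 1 :=
    opNorm_lt_one_of_363_261 (g := toB6 g Rr H) (fun p : S × ι => blk p.1) d ρc αc _ hθc0 hαcρ hdnn h261c hθc h363
  have h365l : E = Gp + Gp * V * E := eq365_end_left Gp V hW
  have h365r : E = Gp + E * V * Gp := by
    have h := eq365_end Gp (V * Gp) hW
    rwa [← mul_assoc] at h
  have h365 := eq365b_hom Qc Qc' Fc Qcs Qcs' Fcs Gp E V h357 h357s h365l h365r
  have h367 : Tinv - Linv = -(Tinv * cPrimeHom Qc Fc Qcs Fcs Gp E V * Linv) := by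
    have e1 : Tinv - Linv = Tinv * ((Qc ∘ₗ (Gp * Gp) ∘ₗ Qcs) * Linv) - Tinv * (Qc' ∘ₗ (E * E) ∘ₗ Qcs') * Linv := by
      rw [hLinv, hTl, mul_one, one_mul]
    rw [e1, h365, mul_add, add_mul, ← mul_assoc]
    abel
  -- the two kernel bounds at the rate `δ_G`
  have h348G : ∀ y y' : g.Site, |B9Thm34Inv.ker (B9Thm34Inv.vol g d) Linv y y'| ≤
      B₁ * g.len y ^ (-(4 : ℝ)) * g.len y' ^ (-(d : ℝ)) * Real.exp (-(δG * g.dist y y')) := fun y y' =>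
    (h348 y y').trans (mul_le_mul_of_nonneg_left
      (Real.exp_le_exp.mpr (neg_le_neg (mul_le_mul_of_nonneg_right hGδ₀ (hdnn y y'))))
      (mul_nonneg (mul_nonneg hB₁.le (Real.rpow_nonneg (hlen y).le _)) (Real.rpow_nonneg (hlen y').le _)))
  have h348T : ∀ y y' : g.Site, |B9Thm34Inv.ker (B9Thm34Inv.vol g d) Tinv y y'| ≤
      Bc' * g.len y ^ (-(4 : ℝ)) * g.len y' ^ (-(d : ℝ)) * Real.exp (-(δG * g.dist y y')) := fun y y' => by
    rw [hBc']
    exact (hTker y y').trans (mul_le_mul_of_nonneg_left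
      (Real.exp_le_exp.mpr (neg_le_neg (mul_le_mul_of_nonneg_right hrCinv (hdnn y y'))))
      (mul_nonneg (mul_nonneg (mul_nonneg (mul_nonneg zero_le_two hB₁.le) hc₁v'.le) (Real.rpow_nonneg (hlen y).le _))
        (Real.rpow_nonneg (hlen y').le _)))
  -- §1: (3.77) for the concrete `P₁(A)` with `C⁻¹(U′U) = Tinv`, `C′(A)` the concrete (3.66) letter
  have hP₁ := hasMajorant_pPrime_coarse (Rr := Rr) (H := H) b T U blk d δ₀ δP δG α β ρ₁ α'' Λ Λρ₁ κQ BG B₁ Bc' κC cF Cq a₀ κP κP' α₁ d₀ M₂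
    kQ kF sQ sF cfun w hκQ.le hBG.le hB₁.le hBc0 hκC0 hcF.le hCq ha₀ hα₁ hΛ hα hβ hδ₀.le hδP0 hM₂ hrG hr1 hα''1 hα''0 hρ₁ hα''ρ hα''ρ2
    hα''ρ3 hΛρ₁ hr368 hκP hdnn htri hrefl hsym hlen h261 h261'' hT1 hT2 hT1i hT2i hT4 hTρ₁ hrepr hη A hsmall hU1 h337B h337F h337Bτ hA hAτB
    hd₀B hd₀F hd₀0 h342_1G h342_2G h342_3G rep hrep h357 h357s h367 hQc' hQcs' hFc' hFcs' h348G h348T h366G hw hcard hkQ hkF hsQ hsF hcfun hθ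
    hθL hK1 hK3
  exact ⟨Tinv, hTl, hTr, hP₁⟩

end CInv

/-! ## §3  The printed quantifiers: thresholds by continuity at `α₁ = 0`, an `α₁`-independent constant -/

section Threshold

variable {𝔸 : Type*} [NormedRing 𝔸] [NormedAlgebra ℂ 𝔸] [CompleteSpace 𝔸] {ι : Type} [Fintype ι]
variable (b : Module.Basis ι ℝ 𝔸) {S : Type} {κ : Type} [Fintype κ] [LinearOrder κ]
variable (T : κ → Equiv.Perm S) (U : κ → S → 𝔸ˣ)
variable {g : B9.Geometry} [Fintype g.Site] {Rr : ℝ} {H : Prop}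

omit [LinearOrder κ] in
set_option maxHeartbeats 1600000 in
/-- **(3.49) FOR `P(U)` AND (3.68) FOR THE CONCRETE `P′(A)` WITH THE PRINTED QUANTIFIERS** — «for α₁ sufficiently small» (pp. 400, 402, 403):
`∃ a₁ > 0 ∃ K ≧ 0 ∀ α₁ ≦ a₁ ∀ A` in (3.37) (blockwise) `∀` (3.57)/(3.59) letters `F′₂(A)`, `F′₂*(A)` of size `O(1)α₁`, `∀ kF, sF` ((3.59) kernels): THERE
EXISTS `C⁻¹(U′U)` (two-sided inverse of `Q′(U′U)G′²(U′U)Q′*(U′U)` on 𝔅, `G′(U′U) = gPrimeExtEnd G′ (V′G′)`) such that the four entries (3.49) of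
`P(U) = G′ ∘ Q′* ∘ C⁻¹ ∘ Q′ ∘ G′` hold at `(K, δ₀/4)` and the four entries (3.68) of the concrete `P′(A)` built with `C⁻¹(U′U)` at `(K·α₁, δ₀/4)`,
`K` INDEPENDENT of `α₁` and `A`; inputs = Theorem 3.1 (3.42)₁₋₃ for `G′(U)` and Theorem 3.2 for `U` at the rate `δ₀`, [4] Lemma 2.1 at `δ₀` for
every exponent, the p. 398 scale transfer for every exponent, the (3.19) letters, the `A`-free (3.60) data (FILE 25's `exists_threshold_pOne`
hypotheses verbatim).  PROOF: FILE 25's cascade and thresholds; `K = κ_P + sup κ_{P′}(α₁)` by `exists_bound_of_continuousAt`; then §2.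
[cite: Balaban1985BackgroundPropagators, Thm 3.4 p.400 + (3.49) p.399 + (3.68) p.403 + p.402 + Thm 3.1 (3.42) p.397 + Thm 3.2 (3.48) p.398 + p.398 remark + (3.19)/(3.21)/(3.25) pp.393–394 + (3.57)–(3.67) pp.401–403 + (3.37) p.396; Balaban1984PropagatorsII, Lemma 2.1 p.234 + (2.51)–(2.55) p.232 + (2.66) p.234; Balaban1985Variational, (135) p.298] -/
theorem exists_threshold_pPrime [Fintype S] [DecidableEq S] [DecidableEq ι] [DecidableEq g.Site] [Nonempty g.Site] (blk : S → g.Site) (d : ℕ)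
    (δ₀ κQ BG B₁ cF Cq a₀ d₀ M₂ : ℝ)
    (kQ : g.Site → S → 𝔸 →L[ℝ] 𝔸) (sQ : S → 𝔸 →L[ℝ] 𝔸) (cfun w : g.Site → ℝ)
    (hκQ : 0 < κQ) (hBG : 0 < BG) (hB₁ : 0 < B₁) (hcF : 0 < cF) (hCq : 0 ≤ Cq) (ha₀ : 0 ≤ a₀) (hM₂ : 0 ≤ M₂) (hδ₀ : 0 < δ₀)
    -- the multiscale geometry 𝔅 and its axioms
    (hdnn : ∀ a a' : g.Site, 0 ≤ g.dist a a') (htri : Triangle254 (toB6 g Rr H)) (hrefl : ∀ y : g.Site, g.dist y y = 0)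
    (hsym : ∀ y y' : g.Site, g.dist y y' = g.dist y' y) (hlen : ∀ y : g.Site, 0 < g.len y) (hlenη : ∀ y : g.Site, g.eta ≤ g.len y)
    (hη : 0 < g.eta)
    -- [4] Lemma 2.1 (2.61) at the rate `δ₀`, «for every 0 < α < 1», and the p. 398 scale transfer for every exponent
    (h261 : ∀ α : ℝ, 0 < α → α < 1 → Ineq261 d (toB6 g Rr H) δ₀ α)
    (hST : ∀ α : ℝ, 0 < α → ∃ Λ : ℝ, 1 ≤ Λ ∧ ScaleTransfer g δ₀ α Λ (fun a => g.len a) ∧ ScaleTransfer g δ₀ α Λ (fun a => g.len a ^ 2) ∧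
      ScaleTransfer g δ₀ α Λ (fun a => (g.len a)⁻¹) ∧ ScaleTransfer g δ₀ α Λ (fun a => (g.len a ^ 2)⁻¹) ∧
      ScaleTransfer g δ₀ α Λ (fun a => (g.len a ^ 4)⁻¹) ∧ ScaleTransfer g δ₀ α Λ (fun y => g.len y ^ (-(4 : ℝ))))
    (hrepr : ∀ (v : 𝔸) (i : ι), |b.repr v i| ≤ M₂ * ‖v‖)
    (hU1 : ∀ m z, ‖((U m z : 𝔸ˣ) : 𝔸)‖ ≤ 1 ∧ ‖(((U m z)⁻¹ : 𝔸ˣ) : 𝔸)‖ ≤ 1)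
    (hd₀B : ∀ μ x, g.dist (blk x) (blk ((T μ).symm x)) ≤ d₀) (hd₀F : ∀ μ x, g.dist (blk x) (blk (T μ x)) ≤ d₀)
    (hd₀0 : ∀ y : g.Site, g.dist y y ≤ d₀)
    -- the `A`-independent data of the concrete `V′(A)` of (3.60)
    (hw : ∀ y, 0 ≤ w y) (hcard : ∀ y, ((B9Eq360Vprime.block blk y).card : ℝ) * w y ≤ 1)
    (hkQ : ∀ y x, blk x = y → ‖kQ y x‖ ≤ w y) (hsQ : ∀ x, ‖sQ x‖ ≤ 1) (hcfun : ∀ y, |cfun y| ≤ a₀ * (g.len y ^ 2)⁻¹)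
    -- THEOREM 3.1 for `G′(U)`: (3.42)₁,₂,₃ at the rate `δ₀`
    {Gp : Module.End ℝ (S × ι → ℝ)}
    (h342_1 : HasMajorant (g := toB6 g Rr H) (fun p : S × ι => blk p.1) Gp
      (fun a a' => BG * g.len a ^ 2 * Real.exp (-(δ₀ * g.dist a a'))))
    (h342_2 : ∀ k : κ ⊕ κ, HasMajorant (g := toB6 g Rr H) (fun p : S × ι => blk p.1)
      (conj b (diffLetter T U ((g.eta : ℂ)⁻¹) k) * Gp) (fun a a' => BG * g.len a * Real.exp (-(δ₀ * g.dist a a'))))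
    (h342_3 : ∀ k : κ ⊕ κ, HasMajorant (g := toB6 g Rr H) (fun p : S × ι => blk p.1)
      (Gp * conj b (diffLetter T U ((g.eta : ℂ)⁻¹) k)) (fun a a' => BG * g.len a * Real.exp (-(δ₀ * g.dist a a'))))
    -- the (3.19) letters `Q′(U)`, `Q′*(U)` in their own typing with block-local two-space majorants, a section of the block map (FILE 17)
    (rep : g.Site → S × ι) (hrep : ∀ y : g.Site, blk (rep y).1 = y)
    {Qc : (S × ι → ℝ) →ₗ[ℝ] (g.Site → ℝ)} {Qcs : (g.Site → ℝ) →ₗ[ℝ] (S × ι → ℝ)} {Linv : Module.End ℝ (g.Site → ℝ)}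
    (hQc : HasMajorantHom (g := toB6 g Rr H) (fun p : S × ι => blk p.1) (fun y : g.Site => y) Qc
      (fun a a' : g.Site => κQ * (if a = a' then (1 : ℝ) else 0)))
    (hQcs : HasMajorantHom (g := toB6 g Rr H) (fun y : g.Site => y) (fun p : S × ι => blk p.1) Qcs
      (fun a a' : g.Site => κQ * (if a = a' then (1 : ℝ) else 0)))
    -- THEOREM 3.2 for `U`: (3.21) `C⁻¹ = (Q′G′²Q′*)⁻¹` exists (`hLinv`) with the KERNEL bound (3.48) at the rate `δ₀`
    (hLinv : (Qc ∘ₗ (Gp * Gp) ∘ₗ Qcs) * Linv = 1)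
    (h348 : ∀ y y' : g.Site, |B9Thm34Inv.ker (B9Thm34Inv.vol g d) Linv y y'| ≤
      B₁ * g.len y ^ (-(4 : ℝ)) * g.len y' ^ (-(d : ℝ)) * Real.exp (-(δ₀ * g.dist y y'))) :
    ∃ a₁ : ℝ, 0 < a₁ ∧ ∃ K : ℝ, 0 ≤ K ∧
    ∀ (α₁ : ℝ), 0 ≤ α₁ → α₁ ≤ a₁ →
    -- the exponent field `A` in the domain (3.37), read blockwise, and the `A`-dependent (3.59) data `kF`, `sF`
    ∀ (A : κ → S → 𝔸) (kF : g.Site → S → 𝔸 →L[ℝ] 𝔸) (sF : S → 𝔸 →L[ℝ] 𝔸),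
      (∀ y x, blk x = y → ‖kF y x‖ ≤ Cq * α₁ * w y) → (∀ x, ‖sF x‖ ≤ Cq * α₁) →
      (∀ ν k x, ‖((g.eta : ℂ)⁻¹) • covDstar T U ν (A k) x‖ ≤ α₁ * (g.len (blk x) ^ 2)⁻¹) →
      (∀ μ ν x, ‖((g.eta : ℂ)⁻¹) • covD T U μ (A ν) x‖ ≤ α₁ * (g.len (blk x) ^ 2)⁻¹) →
      (∀ μ x, ‖((g.eta : ℂ)⁻¹) • covDstar T U μ (tauB T U μ (A μ)) x‖ ≤ α₁ * (g.len (blk x) ^ 2)⁻¹) →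
      (∀ k x, ‖A k x‖ ≤ α₁ * (g.len (blk x))⁻¹) → (∀ ν k x, ‖tauB T U ν (A k) x‖ ≤ α₁ * (g.len (blk x))⁻¹) →
    -- the (3.57)/(3.59) letters `F′₂(A)`, `F′₂*(A)` (block-local, size `c_F α₁`)
    ∀ {Qc' Fc : (S × ι → ℝ) →ₗ[ℝ] (g.Site → ℝ)} {Qcs' Fcs : (g.Site → ℝ) →ₗ[ℝ] (S × ι → ℝ)},
      Qc' = Qc + Fc → Qcs' = Qcs + Fcs →
      HasMajorantHom (g := toB6 g Rr H) (fun p : S × ι => blk p.1) (fun y : g.Site => y) Fc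
        (fun a a' : g.Site => cF * α₁ * (if a = a' then (1 : ℝ) else 0)) →
      HasMajorantHom (g := toB6 g Rr H) (fun y : g.Site => y) (fun p : S × ι => blk p.1) Fcs
        (fun a a' : g.Site => cF * α₁ * (if a = a' then (1 : ℝ) else 0)) →
    ∃ Tinv : Module.End ℝ (g.Site → ℝ),
      Tinv * (Qc' ∘ₗ ((gPrimeExtEnd Gp (conj b (vPrimeConc T U g.eta A blk kQ kF sQ sF cfun) * Gp)) * (gPrimeExtEnd Gp (conj b (vPrimeConc T U g.eta A blk kQ kF sQ sF cfun) * Gp))) ∘ₗ Qcs') = 1 ∧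
      (Qc' ∘ₗ ((gPrimeExtEnd Gp (conj b (vPrimeConc T U g.eta A blk kQ kF sQ sF cfun) * Gp)) * (gPrimeExtEnd Gp (conj b (vPrimeConc T U g.eta A blk kQ kF sQ sF cfun) * Gp))) ∘ₗ Qcs') * Tinv = 1 ∧
      HasMajorant (g := toB6 g Rr H) (fun p : S × ι => blk p.1) (Gp ∘ₗ Qcs ∘ₗ Linv ∘ₗ Qc ∘ₗ Gp)
        (fun a a' => K * Real.exp (-(1 / 4 * δ₀ * g.dist a a'))) ∧
      HasMajorantHom (g := toB6 g Rr H) (fun p : S × ι => blk p.1) (fun q : (κ × S) × ι => blk q.1.2)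
        (conjHom b (gradLin T ((g.eta : ℂ)⁻¹) U) ∘ₗ (Gp ∘ₗ Qcs ∘ₗ Linv ∘ₗ Qc ∘ₗ Gp))
        (fun a a' => K * (g.len a)⁻¹ * Real.exp (-(1 / 4 * δ₀ * g.dist a a'))) ∧
      HasMajorantHom (g := toB6 g Rr H) (fun q : (κ × S) × ι => blk q.1.2) (fun p : S × ι => blk p.1)
        ((Gp ∘ₗ Qcs ∘ₗ Linv ∘ₗ Qc ∘ₗ Gp) ∘ₗ conjHom b (divLin T ((g.eta : ℂ)⁻¹) U))
        (fun a a' => K * (g.len a)⁻¹ * Real.exp (-(1 / 4 * δ₀ * g.dist a a'))) ∧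
      HasMajorant (g := toB6 g Rr H) (fun q : (κ × S) × ι => blk q.1.2)
        (conjHom b (gradLin T ((g.eta : ℂ)⁻¹) U) ∘ₗ (Gp ∘ₗ Qcs ∘ₗ Linv ∘ₗ Qc ∘ₗ Gp) ∘ₗ conjHom b (divLin T ((g.eta : ℂ)⁻¹) U))
        (fun a a' => K * (g.len a ^ 2)⁻¹ * Real.exp (-(1 / 4 * δ₀ * g.dist a a'))) ∧
      HasMajorant (g := toB6 g Rr H) (fun p : S × ι => blk p.1) (B9Eq360Vprime.pPrime Gp (gPrimeExtEnd Gp (conj b (vPrimeConc T U g.eta A blk kQ kF sQ sF cfun) * Gp)) (Qcs ∘ₗ secRes rep) (Qcs' ∘ₗ secRes rep) (secConj rep Linv) (secConj rep Tinv) (secExt rep ∘ₗ Qc) (secExt rep ∘ₗ Qc'))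
        (fun a a' => K * α₁ * Real.exp (-(1 / 4 * δ₀ * g.dist a a'))) ∧
      HasMajorantHom (g := toB6 g Rr H) (fun p : S × ι => blk p.1) (fun q : (κ × S) × ι => blk q.1.2)
        (conjHom b (gradLin T ((g.eta : ℂ)⁻¹) U) ∘ₗ (B9Eq360Vprime.pPrime Gp (gPrimeExtEnd Gp (conj b (vPrimeConc T U g.eta A blk kQ kF sQ sF cfun) * Gp)) (Qcs ∘ₗ secRes rep) (Qcs' ∘ₗ secRes rep) (secConj rep Linv) (secConj rep Tinv) (secExt rep ∘ₗ Qc) (secExt rep ∘ₗ Qc')))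
        (fun a a' => K * α₁ * (g.len a)⁻¹ * Real.exp (-(1 / 4 * δ₀ * g.dist a a'))) ∧
      HasMajorantHom (g := toB6 g Rr H) (fun q : (κ × S) × ι => blk q.1.2) (fun p : S × ι => blk p.1)
        ((B9Eq360Vprime.pPrime Gp (gPrimeExtEnd Gp (conj b (vPrimeConc T U g.eta A blk kQ kF sQ sF cfun) * Gp)) (Qcs ∘ₗ secRes rep) (Qcs' ∘ₗ secRes rep) (secConj rep Linv) (secConj rep Tinv) (secExt rep ∘ₗ Qc) (secExt rep ∘ₗ Qc')) ∘ₗ conjHom b (divLin T ((g.eta : ℂ)⁻¹) U))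
        (fun a a' => K * α₁ * (g.len a)⁻¹ * Real.exp (-(1 / 4 * δ₀ * g.dist a a'))) ∧
      HasMajorant (g := toB6 g Rr H) (fun q : (κ × S) × ι => blk q.1.2)
        (conjHom b (gradLin T ((g.eta : ℂ)⁻¹) U) ∘ₗ (B9Eq360Vprime.pPrime Gp (gPrimeExtEnd Gp (conj b (vPrimeConc T U g.eta A blk kQ kF sQ sF cfun) * Gp)) (Qcs ∘ₗ secRes rep) (Qcs' ∘ₗ secRes rep) (secConj rep Linv) (secConj rep Tinv) (secExt rep ∘ₗ Qc) (secExt rep ∘ₗ Qc')) ∘ₗ conjHom b (divLin T ((g.eta : ℂ)⁻¹) U))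
        (fun a a' => K * α₁ * (g.len a ^ 2)⁻¹ * Real.exp (-(1 / 4 * δ₀ * g.dist a a'))) := by
  classical
  obtain ⟨y₀⟩ := ‹Nonempty g.Site›
  have hSb : 0 ≤ ∑ i, ‖b i‖ := Finset.sum_nonneg fun i _ => norm_nonneg _
  -- the p. 398 scale transfers at the exponents of the cascade
  obtain ⟨Λ, hΛ, hT1, hT2, hT1i, hT2i, hT4, -⟩ := hST (1 / 100) (by norm_num)
  obtain ⟨Λρ₁, hΛρ₁1, hTρ₁0, -, -, -, -, -⟩ := hST (1 / 100 * (33 / 100)) (by norm_num)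
  obtain ⟨c₄, hc₄1, -, -, -, -, -, hT4v⟩ := hST (1 / 10) (by norm_num)
  have hTρ₁ : ScaleTransfer g (33 / 100 * δ₀) (1 / 100) Λρ₁ (fun a => g.len a) := scaleTransfer_rescale hTρ₁0
  have hΛ0 : 0 < Λ := zero_lt_one.trans_le hΛ
  have hΛρ₁ : 0 ≤ Λρ₁ := zero_le_one.trans hΛρ₁1
  have hc₄ : 0 < c₄ := zero_lt_one.trans_le hc₄1
  -- [4] Lemma 2.1 at the (rate, exponent) pairs of the cascade, all read from the one printed rate `δ₀`
  have h261β : Ineq261 d (toB6 g Rr H) δ₀ (1 / 100) := h261 _ (by norm_num) (by norm_num)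
  have h261'' : Ineq261 d (toB6 g Rr H) (33 / 100 * δ₀) (1 / 100) :=
    ineq261_rescale (h261 (1 / 100 * (33 / 100)) (by norm_num) (by norm_num))
  have h261c : Ineq261 d (toB6 g Rr H) (49 / 50 * δ₀) (1 / 100) :=
    ineq261_rescale (h261 (1 / 100 * (49 / 50)) (by norm_num) (by norm_num))
  have h261v : Ineq261 d (toB6 g Rr H) δ₀ (1 / 2 + 1 / 10) := h261 _ (by norm_num) (by norm_num)
  have h261v' : Ineq261 d (toB6 g Rr H) ((1 / 2 - 1 / 10) * δ₀) (1 / 10) :=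
    ineq261_rescale (h261 (1 / 10 * (1 / 2 - 1 / 10)) (by norm_num) (by norm_num))
  -- `c₁ > 0` at these pairs (non-empty 𝔅)
  have hc₂ : 0 < B6.c1 d δ₀ (1 / 100) := c1_pos_of_ineq261 h261β y₀ (hrefl y₀)
  have hc'' : 0 < B6.c1 d (33 / 100 * δ₀) (1 / 100) := c1_pos_of_ineq261 h261'' y₀ (hrefl y₀)
  have hcc' : 0 < B6.c1 d (49 / 50 * δ₀) (1 / 100) := c1_pos_of_ineq261 h261c y₀ (hrefl y₀)
  have hc₁v : 0 < B6.c1 d δ₀ (1 / 2 + 1 / 10) := c1_pos_of_ineq261 h261v y₀ (hrefl y₀)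
  have hc₁v' : 0 < B6.c1 d ((1 / 2 - 1 / 10) * δ₀) (1 / 10) := c1_pos_of_ineq261 h261v' y₀ (hrefl y₀)
  -- the linear side conditions of the cascade
  have hδP0 : (0 : ℝ) ≤ 1 / 4 * δ₀ := by linarith only [hδ₀]
  have hrG : 1 / 4 * δ₀ + (2 * (1 / 100) + 1 / 100) * δ₀ ≤ 7 / 20 * δ₀ := by linarith only [hδ₀]
  have hr1 : 33 / 100 * δ₀ + (1 / 100 + 1 / 100) * δ₀ ≤ 7 / 20 * δ₀ := by linarith only [hδ₀]
  have hr368 : 1 / 4 * δ₀ + 2 * ((2 * (1 / 100) + 1 / 100) * δ₀) ≤ B9Ineq368Vprime.rateC (1 / 100) (33 / 100 * δ₀) := by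
    unfold B9Ineq368Vprime.rateC; linarith only [hδ₀]
  have hrc1 : 49 / 50 * δ₀ + (1 / 100 + 1 / 100) * δ₀ ≤ δ₀ := by linarith only [hδ₀]
  have hrc : δ₀ / 2 + (1 / 100 + 1 / 100) * δ₀ ≤ (1 - 1 / 100) * (49 / 50 * δ₀) := by linarith only [hδ₀]
  have hrcG : 7 / 20 * δ₀ + (1 / 100 + 1 / 100) * δ₀ ≤ (1 - 1 / 100) * (49 / 50 * δ₀) := by linarith only [hδ₀]
  have hGδ1 : 7 / 20 * δ₀ ≤ δ₀ := by linarith only [hδ₀]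
  have hrCinv : 7 / 20 * δ₀ ≤ (1 - 1 / 10) * ((1 / 2 - 1 / 10) * δ₀) := by linarith only [hδ₀]
  have hρ₁0 : 0 ≤ 33 / 100 * δ₀ := by linarith only [hδ₀]
  have hρc0 : 0 ≤ 49 / 50 * δ₀ := by linarith only [hδ₀]
  have hα''ρ : 0 ≤ (1 - 1 / 100) * (33 / 100 * δ₀) := by linarith only [hδ₀]
  have hα''ρ2 : 0 ≤ (1 - 2 * (1 / 100)) * (33 / 100 * δ₀) := by linarith only [hδ₀]
  have hα''ρ3 : 0 ≤ (1 - 3 * (1 / 100)) * (33 / 100 * δ₀) := by linarith only [hδ₀]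
  -- «for α₁ sufficiently small» (pp. 402, 403): the four threshold functions of the `C⁻¹(U′U)`/`P′(A)`-chain are CONTINUOUS AT `α₁ = 0` and vanish there
  obtain ⟨ε₁, hε₁, hF1⟩ := exists_threshold_of_continuousAt
    (f := fun α₁ : ℝ => theta363 (Fintype.card κ) 1 α₁ a₀ Cq M₂ (∑ i, ‖b i‖) (Real.exp (δ₀ * d₀)) BG Λ (B6.c1 d δ₀ (1 / 100)) * B6.c1 d (49 / 50 * δ₀) (1 / 100))
    (by unfold theta363 kappa385 cVConc cBConc; fun_prop) (by simp [theta363])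
  obtain ⟨ε₂, hε₂, hF2⟩ := exists_threshold_of_continuousAt
    (f := fun α₁ : ℝ => theta363 (Fintype.card κ) 1 α₁ a₀ Cq M₂ (∑ i, ‖b i‖) (Real.exp (7 / 20 * δ₀ * d₀)) BG Λ (B6.c1 d δ₀ (1 / 100)) * B6.c1 d (33 / 100 * δ₀) (1 / 100))
    (by unfold theta363 kappa385 cVConc cBConc; fun_prop) (by simp [theta363])
  obtain ⟨ε₃, hε₃, hF3⟩ := exists_threshold_of_continuousAt
    (f := fun α₁ : ℝ => thetaL363 (Fintype.card κ) 1 α₁ a₀ Cq M₂ (∑ i, ‖b i‖) (Real.exp (7 / 20 * δ₀ * d₀)) BG Λ (B6.c1 d δ₀ (1 / 100)) * B6.c1 d (33 / 100 * δ₀) (1 / 100))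
    (by unfold thetaL363 kappa385 cVConc cBConc; fun_prop) (by simp [thetaL363])
  obtain ⟨ε₅, hε₅, hF5⟩ := exists_threshold_of_continuousAt
    (f := fun α₁ : ℝ => α₁ * (2 * (kappa366 κQ cF (kappa385 1 (cVConc (Fintype.card κ) 1 α₁ a₀ Cq M₂ (∑ i, ‖b i‖) (Real.exp (δ₀ * d₀))) 0 0 Λ (B6.c1 d δ₀ (1 / 100))) BG (BG * B6.c1 d (49 / 50 * δ₀) (1 / 100) * (1 - theta363 (Fintype.card κ) 1 α₁ a₀ Cq M₂ (∑ i, ‖b i‖) (Real.exp (δ₀ * d₀)) BG Λ (B6.c1 d δ₀ (1 / 100)) * B6.c1 d (49 / 50 * δ₀) (1 / 100))⁻¹) Λ (B6.c1 d δ₀ (1 / 100)) α₁ * B₁ * c₄ * B6.c1 d δ₀ (1 / 2 + 1 / 10)) * B6.c1 d ((1 / 2 - 1 / 10) * δ₀) (1 / 10)))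
    (by
      unfold theta363 kappa366 kappa385 cVConc cBConc
      fun_prop (disch := simp))
    (by simp)
  -- the constant `κ₁(α₁)` of (3.77) (FILE 16/20's explicit `κ₃₇₇(…)`) is continuous at `α₁ = 0`: a bound `K` below a threshold
  obtain ⟨K, ε₆, hK0, hε₆, hF6⟩ := exists_bound_of_continuousAt
    (f := fun α₁ : ℝ => (kappa368 κQ cF (kappa385 1 (cVConc (Fintype.card κ) 1 α₁ a₀ Cq M₂ (∑ i, ‖b i‖) (Real.exp (7 / 20 * δ₀ * d₀))) 0 0 Λ (B6.c1 d δ₀ (1 / 100))) (kappa366 κQ cF (kappa385 1 (cVConc (Fintype.card κ) 1 α₁ a₀ Cq M₂ (∑ i, ‖b i‖) (Real.exp (δ₀ * d₀))) 0 0 Λ (B6.c1 d δ₀ (1 / 100))) BG (BG * B6.c1 d (49 / 50 * δ₀) (1 / 100) * (1 - theta363 (Fintype.card κ) 1 α₁ a₀ Cq M₂ (∑ i, ‖b i‖) (Real.exp (δ₀ * d₀)) BG Λ (B6.c1 d δ₀ (1 / 100)) * B6.c1 d (49 / 50 * δ₀) (1 / 100))⁻¹) Λ (B6.c1 d δ₀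 (1 / 100)) α₁) BG BG (BG * B6.c1 d (33 / 100 * δ₀) (1 / 100) * (1 - theta363 (Fintype.card κ) 1 α₁ a₀ Cq M₂ (∑ i, ‖b i‖) (Real.exp (7 / 20 * δ₀ * d₀)) BG Λ (B6.c1 d δ₀ (1 / 100)) * B6.c1 d (33 / 100 * δ₀) (1 / 100))⁻¹) B₁ (2 * B₁ * B6.c1 d ((1 / 2 - 1 / 10) * δ₀) (1 / 10)) Λ (B6.c1 d δ₀ (1 / 100)) α₁ + ↑(Fintype.card κ) * kappa368Ds κQ cF (kappa385 BG (cVConc (Fintype.card κ) 1 α₁ a₀ Cq M₂ (∑ i, ‖b i‖) (Real.exp (7 / 20 * δ₀ * d₀))) 0 0 Λ (B6.c1 d δ₀ (1 / 100))) (kappa366 κQ cF (kappa385 1 (cVConc (Fintype.card κ) 1 α₁ a₀ Cq M₂ (∑ i, ‖b i‖) (Real.exp (δ₀ * d₀))) 0 0 Λ (B6.c1 d δ₀ (1 / 100))) BG (BG * B6.c1 d (49 / 50 * δ₀) (1 / 100) * (1 - theta363 (Fintype.card κ) 1 α₁ a₀ Cq M₂ (∑ i, ‖b i‖) (Real.exp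 (δ₀ * d₀)) BG Λ (B6.c1 d δ₀ (1 / 100)) * B6.c1 d (49 / 50 * δ₀) (1 / 100))⁻¹) Λ (B6.c1 d δ₀ (1 / 100)) α₁) BG BG BG (B6.c1 d (33 / 100 * δ₀) (1 / 100) * (1 - theta363 (Fintype.card κ) 1 α₁ a₀ Cq M₂ (∑ i, ‖b i‖) (Real.exp (7 / 20 * δ₀ * d₀)) BG Λ (B6.c1 d δ₀ (1 / 100)) * B6.c1 d (33 / 100 * δ₀) (1 / 100))⁻¹) (BG * Λρ₁ ^ 2 * B6.c1 d (33 / 100 * δ₀) (1 / 100) * (1 - thetaL363 (Fintype.card κ) 1 α₁ a₀ Cq M₂ (∑ i, ‖b i‖) (Real.exp (7 / 20 * δ₀ * d₀)) BG Λ (B6.c1 d δ₀ (1 / 100)) * B6.c1 d (33 / 100 * δ₀) (1 / 100))⁻¹) B₁ (2 * B₁ * B6.c1 d ((1 / 2 - 1 / 10) * δ₀) (1 / 10)) (cBConc (Fintype.card κ) M₂ (∑ i, ‖b i‖) (Real.exp (B9Ineq368Vprime.rateC (1 / 100) (33 / 100 * δ₀) * d₀))) (cCConc (Fintype.card κ)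 1 α₁ a₀ Cq M₂ (∑ i, ‖b i‖) (Real.exp (B9Ineq368Vprime.rateC (1 / 100) (33 / 100 * δ₀) * d₀))) Λ (B6.c1 d δ₀ (1 / 100)) α₁))
    (by
      unfold theta363 thetaL363 kappa368 kappa368Ds kappa366 kappa385 cCConc cVConc cBConc
      fun_prop (disch := simp))
  -- the threshold `a₁` and the `α₁`-independent constant `κ_P + K`
  have hκP0 : 0 ≤ kappa349 κQ ((1 + Fintype.card κ) * BG) B₁ Λ (B6.c1 d δ₀ (1 / 100)) := kappa349_nonneg hB₁.le
  refine ⟨min (min (min ε₁ ε₂) (min ε₃ ε₅)) (min ε₆ (1 / 2)) / 2,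
    half_pos (lt_min (lt_min (lt_min hε₁ hε₂) (lt_min hε₃ hε₅)) (lt_min hε₆ one_half_pos)), kappa349 κQ ((1 + Fintype.card κ) * BG) B₁ Λ (B6.c1 d δ₀ (1 / 100)) + K, add_nonneg hκP0 hK0, ?_⟩
  intro α₁ hα₁0 hα₁1 A kF sF hkF hsF h337B h337F h337Bτ hA hAτB Qc' Fc Qcs' Fcs h357 h357s hFc hFcs
  have hmε₁ : min (min (min ε₁ ε₂) (min ε₃ ε₅)) (min ε₆ (1 / 2)) ≤ ε₁ := (min_le_left _ _).trans ((min_le_left _ _).trans (min_le_left _ _))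
  have hmε₂ : min (min (min ε₁ ε₂) (min ε₃ ε₅)) (min ε₆ (1 / 2)) ≤ ε₂ := (min_le_left _ _).trans ((min_le_left _ _).trans (min_le_right _ _))
  have hmε₃ : min (min (min ε₁ ε₂) (min ε₃ ε₅)) (min ε₆ (1 / 2)) ≤ ε₃ := (min_le_left _ _).trans ((min_le_right _ _).trans (min_le_left _ _))
  have hmε₅ : min (min (min ε₁ ε₂) (min ε₃ ε₅)) (min ε₆ (1 / 2)) ≤ ε₅ := (min_le_left _ _).trans ((min_le_right _ _).trans (min_le_right _ _))
  have hmε₆ : min (min (min ε₁ ε₂) (min ε₃ ε₅)) (min ε₆ (1 / 2)) ≤ ε₆ := (min_le_right _ _).trans (min_le_left _ _)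
  have hmh : min (min (min ε₁ ε₂) (min ε₃ ε₅)) (min ε₆ (1 / 2)) ≤ 1 / 2 := (min_le_right _ _).trans (min_le_right _ _)
  have habs : |α₁| = α₁ := abs_of_nonneg hα₁0
  have h1 : theta363 (Fintype.card κ) 1 α₁ a₀ Cq M₂ (∑ i, ‖b i‖) (Real.exp (δ₀ * d₀)) BG Λ (B6.c1 d δ₀ (1 / 100)) * B6.c1 d (49 / 50 * δ₀) (1 / 100) < 1 / 2 := hF1 α₁ (by rw [habs]; linarith only [hα₁1, hmε₁, hε₁])
  have h2 : theta363 (Fintype.card κ) 1 α₁ a₀ Cq M₂ (∑ i, ‖b i‖) (Real.exp (7 / 20 * δ₀ * d₀)) BG Λ (B6.c1 d δ₀ (1 / 100)) * B6.c1 d (33 / 100 * δ₀) (1 / 100) < 1 / 2 := hF2 α₁ (by rw [habs]; linarith only [hα₁1, hmε₂, hε₂])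
  have h3 : thetaL363 (Fintype.card κ) 1 α₁ a₀ Cq M₂ (∑ i, ‖b i‖) (Real.exp (7 / 20 * δ₀ * d₀)) BG Λ (B6.c1 d δ₀ (1 / 100)) * B6.c1 d (33 / 100 * δ₀) (1 / 100) < 1 / 2 := hF3 α₁ (by rw [habs]; linarith only [hα₁1, hmε₃, hε₃])
  have h5 : α₁ * (2 * (kappa366 κQ cF (kappa385 1 (cVConc (Fintype.card κ) 1 α₁ a₀ Cq M₂ (∑ i, ‖b i‖) (Real.exp (δ₀ * d₀))) 0 0 Λ (B6.c1 d δ₀ (1 / 100))) BG (BG * B6.c1 d (49 / 50 * δ₀) (1 / 100) * (1 - theta363 (Fintype.card κ) 1 α₁ a₀ Cq M₂ (∑ i, ‖b i‖) (Real.exp (δ₀ * d₀)) BG Λ (B6.c1 d δ₀ (1 / 100)) * B6.c1 d (49 / 50 * δ₀) (1 / 100))⁻¹) Λ (B6.c1 d δ₀ (1 / 100)) α₁ * B₁ * c₄ * B6.c1 d δ₀ (1 / 2 + 1 / 10)) * B6.c1 d ((1 / 2 - 1 / 10) * δ₀) (1 / 10)) < 1 / 2 :=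
    hF5 α₁ (by rw [habs]; linarith only [hα₁1, hmε₅, hε₅])
  have h6 := hF6 α₁ (by rw [habs]; linarith only [hα₁1, hmε₆, hε₆])
  have hhalf : (1 / 2 : ℝ) < 1 := by norm_num
  -- `η·α₁(Lʲη)⁻¹ ≦ 1/4` from `α₁ ≦ 1/4` and `η ≦ Lʲη`
  have hsmall : ∀ y : g.Site, g.eta * (α₁ * (g.len y)⁻¹) ≤ 1 / 4 := fun y => by
    have hq : g.eta * (g.len y)⁻¹ ≤ 1 := by
      rw [← div_eq_mul_inv]; exact (div_le_one (hlen y)).mpr (hlenη y)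
    calc g.eta * (α₁ * (g.len y)⁻¹) = α₁ * (g.eta * (g.len y)⁻¹) := by ring
      _ ≤ α₁ * 1 := mul_le_mul_of_nonneg_left hq hα₁0
      _ ≤ 1 / 4 := by linarith only [hα₁1, hmh]
  -- signs of the explicit constants at this `α₁`
  have hcV0E : ∀ E : ℝ, 0 ≤ E →
      0 ≤ kappa385 1 (cVConc (Fintype.card κ) 1 α₁ a₀ Cq M₂ (∑ i, ‖b i‖) E) 0 0 Λ (B6.c1 d δ₀ (1 / 100)) := fun E hE =>
    kappa385_nonneg zero_le_one (cVConc_nonneg hα₁0 ha₀ hCq hM₂ hSb hE) le_rfl le_rfl hΛ0.le hc₂.le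
  have hcV0G : 0 ≤ kappa385 BG (cVConc (Fintype.card κ) 1 α₁ a₀ Cq M₂ (∑ i, ‖b i‖) (Real.exp (7 / 20 * δ₀ * d₀))) 0 0 Λ (B6.c1 d δ₀ (1 / 100)) :=
    kappa385_nonneg hBG.le (cVConc_nonneg hα₁0 ha₀ hCq hM₂ hSb (Real.exp_nonneg _)) le_rfl le_rfl hΛ0.le hc₂.le
  have hNc : 0 < BG * B6.c1 d (49 / 50 * δ₀) (1 / 100) * (1 - theta363 (Fintype.card κ) 1 α₁ a₀ Cq M₂ (∑ i, ‖b i‖) (Real.exp (δ₀ * d₀)) BG Λ (B6.c1 d δ₀ (1 / 100)) * B6.c1 d (49 / 50 * δ₀) (1 / 100))⁻¹ :=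
    mul_pos (mul_pos hBG hcc') (inv_pos.mpr (by linarith only [h1]))
  have hN'' : 0 ≤ BG * B6.c1 d (33 / 100 * δ₀) (1 / 100) * (1 - theta363 (Fintype.card κ) 1 α₁ a₀ Cq M₂ (∑ i, ‖b i‖) (Real.exp (7 / 20 * δ₀ * d₀)) BG Λ (B6.c1 d δ₀ (1 / 100)) * B6.c1 d (33 / 100 * δ₀) (1 / 100))⁻¹ :=
    mul_nonneg (mul_nonneg hBG.le hc''.le) (inv_nonneg.mpr (by linarith only [h2]))
  have hN3 : 0 ≤ B6.c1 d (33 / 100 * δ₀) (1 / 100) * (1 - theta363 (Fintype.card κ) 1 α₁ a₀ Cq M₂ (∑ i, ‖b i‖) (Real.exp (7 / 20 * δ₀ * d₀)) BG Λ (B6.c1 d δ₀ (1 / 100)) * B6.c1 d (33 / 100 * δ₀) (1 / 100))⁻¹ :=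
    mul_nonneg hc''.le (inv_nonneg.mpr (by linarith only [h2]))
  have hN3L : 0 ≤ BG * Λρ₁ ^ 2 * B6.c1 d (33 / 100 * δ₀) (1 / 100) * (1 - thetaL363 (Fintype.card κ) 1 α₁ a₀ Cq M₂ (∑ i, ‖b i‖) (Real.exp (7 / 20 * δ₀ * d₀)) BG Λ (B6.c1 d δ₀ (1 / 100)) * B6.c1 d (33 / 100 * δ₀) (1 / 100))⁻¹ :=
    mul_nonneg (mul_nonneg (mul_nonneg hBG.le (sq_nonneg Λρ₁)) hc''.le) (inv_nonneg.mpr (by linarith only [h3]))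
  have hκC0 : 0 < kappa366 κQ cF (kappa385 1 (cVConc (Fintype.card κ) 1 α₁ a₀ Cq M₂ (∑ i, ‖b i‖) (Real.exp (δ₀ * d₀))) 0 0 Λ (B6.c1 d δ₀ (1 / 100))) BG (BG * B6.c1 d (49 / 50 * δ₀) (1 / 100) * (1 - theta363 (Fintype.card κ) 1 α₁ a₀ Cq M₂ (∑ i, ‖b i‖) (Real.exp (δ₀ * d₀)) BG Λ (B6.c1 d δ₀ (1 / 100)) * B6.c1 d (49 / 50 * δ₀) (1 / 100))⁻¹) Λ (B6.c1 d δ₀ (1 / 100)) α₁ :=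
    kappa366_pos hκQ hcF (hcV0E _ (Real.exp_nonneg _)) hNc hΛ0 hc₂ hα₁0
  have hBc0 : 0 ≤ 2 * B₁ * B6.c1 d ((1 / 2 - 1 / 10) * δ₀) (1 / 10) := mul_nonneg (mul_nonneg zero_le_two hB₁.le) hc₁v'.le
  have hK1nn : 0 ≤ kappa368 κQ cF (kappa385 1 (cVConc (Fintype.card κ) 1 α₁ a₀ Cq M₂ (∑ i, ‖b i‖) (Real.exp (7 / 20 * δ₀ * d₀))) 0 0 Λ (B6.c1 d δ₀ (1 / 100))) (kappa366 κQ cF (kappa385 1 (cVConc (Fintype.card κ) 1 α₁ a₀ Cq M₂ (∑ i, ‖b i‖) (Real.exp (δ₀ * d₀))) 0 0 Λ (B6.c1 d δ₀ (1 / 100))) BG (BG * B6.c1 d (49 / 50 * δ₀) (1 / 100) * (1 - theta363 (Fintype.card κ) 1 α₁ a₀ Cq M₂ (∑ i, ‖b i‖) (Real.exp (δ₀ * d₀)) BG Λ (B6.c1 d δ₀ (1 / 100)) * B6.c1 d (49 / 50 * δ₀) (1 / 100))⁻¹) Λ (B6.c1 d δ₀ (1 / 100)) α₁) BG BG (BG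 * B6.c1 d (33 / 100 * δ₀) (1 / 100) * (1 - theta363 (Fintype.card κ) 1 α₁ a₀ Cq M₂ (∑ i, ‖b i‖) (Real.exp (7 / 20 * δ₀ * d₀)) BG Λ (B6.c1 d δ₀ (1 / 100)) * B6.c1 d (33 / 100 * δ₀) (1 / 100))⁻¹) B₁ (2 * B₁ * B6.c1 d ((1 / 2 - 1 / 10) * δ₀) (1 / 10)) Λ (B6.c1 d δ₀ (1 / 100)) α₁ :=
    kappa368_nonneg hκQ.le hcF.le (hcV0E _ (Real.exp_nonneg _)) hκC0.le hBG.le hBG.le hN'' hB₁.le hBc0 hc₂.le hα₁0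
  have hcB : 0 ≤ cBConc (Fintype.card κ) M₂ (∑ i, ‖b i‖) (Real.exp (B9Ineq368Vprime.rateC (1 / 100) (33 / 100 * δ₀) * d₀)) := by
    unfold cBConc
    exact mul_nonneg (mul_nonneg zero_le_two (Nat.cast_nonneg _))
      (mul_nonneg (mul_nonneg (mul_nonneg zero_le_two hM₂) hSb) (Real.exp_nonneg _))
  have hcC : 0 ≤ cCConc (Fintype.card κ) 1 α₁ a₀ Cq M₂ (∑ i, ‖b i‖)
      (Real.exp (B9Ineq368Vprime.rateC (1 / 100) (33 / 100 * δ₀) * d₀)) := by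
    unfold cCConc
    have i0 : 0 ≤ 2 + Cq * α₁ := by have := mul_nonneg hCq hα₁0; linarith only [this]
    have i1 : 0 ≤ (2 + 8 * (1 : ℝ) ^ 2 * α₁) * (Fintype.card κ : ℝ) := mul_nonneg (by linarith only [hα₁0]) (Nat.cast_nonneg _)
    have i2 : 0 ≤ a₀ * Cq * (2 + Cq * α₁) := mul_nonneg (mul_nonneg ha₀ hCq) i0
    have i3 : 0 ≤ 4 * (Fintype.card κ : ℝ) * (1 : ℝ) ^ 2 := by positivity
    exact mul_nonneg (mul_nonneg (mul_nonneg (add_nonneg (add_nonneg i1 i2) i3) hM₂) hSb) (Real.exp_nonneg _)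
  have hK3nn : 0 ≤ ↑(Fintype.card κ) * kappa368Ds κQ cF (kappa385 BG (cVConc (Fintype.card κ) 1 α₁ a₀ Cq M₂ (∑ i, ‖b i‖) (Real.exp (7 / 20 * δ₀ * d₀))) 0 0 Λ (B6.c1 d δ₀ (1 / 100))) (kappa366 κQ cF (kappa385 1 (cVConc (Fintype.card κ) 1 α₁ a₀ Cq M₂ (∑ i, ‖b i‖) (Real.exp (δ₀ * d₀))) 0 0 Λ (B6.c1 d δ₀ (1 / 100))) BG (BG * B6.c1 d (49 / 50 * δ₀) (1 / 100) * (1 - theta363 (Fintype.card κ) 1 α₁ a₀ Cq M₂ (∑ i, ‖b i‖) (Real.exp (δ₀ * d₀)) BG Λ (B6.c1 d δ₀ (1 / 100)) * B6.c1 d (49 / 50 * δ₀) (1 / 100))⁻¹) Λ (B6.c1 d δ₀ (1 / 100)) α₁) BG BG BG (B6.c1 d (33 / 100 * δ₀) (1 / 100) * (1 - theta363 (Fintype.card κ) 1 α₁ a₀ Cq M₂ (∑ i, ‖b i‖) (Real.exp (7 / 20 * δ₀ * d₀)) BG Λ (B6.c1 d δ₀ (1 / 100)) * B6.c1 d (33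 / 100 * δ₀) (1 / 100))⁻¹) (BG * Λρ₁ ^ 2 * B6.c1 d (33 / 100 * δ₀) (1 / 100) * (1 - thetaL363 (Fintype.card κ) 1 α₁ a₀ Cq M₂ (∑ i, ‖b i‖) (Real.exp (7 / 20 * δ₀ * d₀)) BG Λ (B6.c1 d δ₀ (1 / 100)) * B6.c1 d (33 / 100 * δ₀) (1 / 100))⁻¹) B₁ (2 * B₁ * B6.c1 d ((1 / 2 - 1 / 10) * δ₀) (1 / 10)) (cBConc (Fintype.card κ) M₂ (∑ i, ‖b i‖) (Real.exp (B9Ineq368Vprime.rateC (1 / 100) (33 / 100 * δ₀) * d₀))) (cCConc (Fintype.card κ) 1 α₁ a₀ Cq M₂ (∑ i, ‖b i‖) (Real.exp (B9Ineq368Vprime.rateC (1 / 100) (33 / 100 * δ₀) * d₀))) Λ (B6.c1 d δ₀ (1 / 100)) α₁ :=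
    mul_nonneg (Nat.cast_nonneg _) (kappa368Ds_nonneg hκQ.le hcF.le hcV0G hκC0.le hBG.le hBG.le hBG.le hN3 hN3L hB₁.le hBc0
      hcB hcC hc₂.le hα₁0)
  have hXpos : 0 < 2 * (kappa366 κQ cF (kappa385 1 (cVConc (Fintype.card κ) 1 α₁ a₀ Cq M₂ (∑ i, ‖b i‖) (Real.exp (δ₀ * d₀))) 0 0 Λ (B6.c1 d δ₀ (1 / 100))) BG (BG * B6.c1 d (49 / 50 * δ₀) (1 / 100) * (1 - theta363 (Fintype.card κ) 1 α₁ a₀ Cq M₂ (∑ i, ‖b i‖) (Real.exp (δ₀ * d₀)) BG Λ (B6.c1 d δ₀ (1 / 100)) * B6.c1 d (49 / 50 * δ₀) (1 / 100))⁻¹) Λ (B6.c1 d δ₀ (1 / 100)) α₁ * B₁ * c₄ * B6.c1 d δ₀ (1 / 2 + 1 / 10)) * B6.c1 d ((1 / 2 - 1 / 10) * δ₀) (1 / 10) :=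
    mul_pos (mul_pos two_pos (mul_pos (mul_pos (mul_pos hκC0 hB₁) hc₄) hc₁v)) hc₁v'
  have ha₁' : α₁ ≤ (2 * (kappa366 κQ cF (kappa385 1 (cVConc (Fintype.card κ) 1 α₁ a₀ Cq M₂ (∑ i, ‖b i‖) (Real.exp (δ₀ * d₀))) 0 0 Λ (B6.c1 d δ₀ (1 / 100))) BG (BG * B6.c1 d (49 / 50 * δ₀) (1 / 100) * (1 - theta363 (Fintype.card κ) 1 α₁ a₀ Cq M₂ (∑ i, ‖b i‖) (Real.exp (δ₀ * d₀)) BG Λ (B6.c1 d δ₀ (1 / 100)) * B6.c1 d (49 / 50 * δ₀) (1 / 100))⁻¹) Λ (B6.c1 d δ₀ (1 / 100)) α₁ * B₁ * c₄ * B6.c1 d δ₀ (1 / 2 + 1 / 10)) * B6.c1 d ((1 / 2 - 1 / 10) * δ₀) (1 / 10))⁻¹ := by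
    rw [inv_eq_one_div, le_div_iff₀ hXpos]; linarith only [h5]
  -- §2 with the cascade, the explicit constants and the thresholds
  obtain ⟨Tinv, hTl, hTr, hP, hDP, hPDs, hDPDs, hPp, hDPp, hPpDs, hDPpDs⟩ := exists_cinv_pPrime_concrete (Rr := Rr) (H := H) b T U blk d
    δ₀ (1 / 4 * δ₀) (7 / 20 * δ₀) δ₀ (49 / 50 * δ₀) (1 / 100) (1 / 10) (1 / 10) c₄ (1 / 100) (1 / 100)
    (33 / 100 * δ₀) (1 / 100) Λ Λρ₁ κQ BG B₁ _ _ cF Cq a₀ _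
    (kappa368 κQ cF (kappa385 1 (cVConc (Fintype.card κ) 1 α₁ a₀ Cq M₂ (∑ i, ‖b i‖) (Real.exp (7 / 20 * δ₀ * d₀))) 0 0 Λ (B6.c1 d δ₀ (1 / 100))) (kappa366 κQ cF (kappa385 1 (cVConc (Fintype.card κ) 1 α₁ a₀ Cq M₂ (∑ i, ‖b i‖) (Real.exp (δ₀ * d₀))) 0 0 Λ (B6.c1 d δ₀ (1 / 100))) BG (BG * B6.c1 d (49 / 50 * δ₀) (1 / 100) * (1 - theta363 (Fintype.card κ) 1 α₁ a₀ Cq M₂ (∑ i, ‖b i‖) (Real.exp (δ₀ * d₀)) BG Λ (B6.c1 d δ₀ (1 / 100)) * B6.c1 d (49 / 50 * δ₀) (1 / 100))⁻¹) Λ (B6.c1 d δ₀ (1 / 100)) α₁) BG BG (BG * B6.c1 d (33 / 100 * δ₀) (1 / 100) * (1 - theta363 (Fintype.card κ) 1 α₁ a₀ Cq M₂ (∑ i, ‖b i‖) (Real.exp (7 / 20 * δ₀ * d₀)) BG Λ (B6.c1 d δ₀ (1 / 100)) * B6.c1 d (33 / 100 * δ₀) (1 / 100))⁻¹) B₁ (2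 * B₁ * B6.c1 d ((1 / 2 - 1 / 10) * δ₀) (1 / 10)) Λ (B6.c1 d δ₀ (1 / 100)) α₁ + ↑(Fintype.card κ) * kappa368Ds κQ cF (kappa385 BG (cVConc (Fintype.card κ) 1 α₁ a₀ Cq M₂ (∑ i, ‖b i‖) (Real.exp (7 / 20 * δ₀ * d₀))) 0 0 Λ (B6.c1 d δ₀ (1 / 100))) (kappa366 κQ cF (kappa385 1 (cVConc (Fintype.card κ) 1 α₁ a₀ Cq M₂ (∑ i, ‖b i‖) (Real.exp (δ₀ * d₀))) 0 0 Λ (B6.c1 d δ₀ (1 / 100))) BG (BG * B6.c1 d (49 / 50 * δ₀) (1 / 100) * (1 - theta363 (Fintype.card κ) 1 α₁ a₀ Cq M₂ (∑ i, ‖b i‖) (Real.exp (δ₀ * d₀)) BG Λ (B6.c1 d δ₀ (1 / 100)) * B6.c1 d (49 / 50 * δ₀) (1 / 100))⁻¹) Λ (B6.c1 d δ₀ (1 / 100)) α₁) BG BG BG (B6.c1 d (33 / 100 * δ₀) (1 / 100) * (1 - theta363 (Fintype.card κ) 1 α₁ a₀ Cq M₂ (∑ i, ‖b i‖) (Real.exp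 (7 / 20 * δ₀ * d₀)) BG Λ (B6.c1 d δ₀ (1 / 100)) * B6.c1 d (33 / 100 * δ₀) (1 / 100))⁻¹) (BG * Λρ₁ ^ 2 * B6.c1 d (33 / 100 * δ₀) (1 / 100) * (1 - thetaL363 (Fintype.card κ) 1 α₁ a₀ Cq M₂ (∑ i, ‖b i‖) (Real.exp (7 / 20 * δ₀ * d₀)) BG Λ (B6.c1 d δ₀ (1 / 100)) * B6.c1 d (33 / 100 * δ₀) (1 / 100))⁻¹) B₁ (2 * B₁ * B6.c1 d ((1 / 2 - 1 / 10) * δ₀) (1 / 10)) (cBConc (Fintype.card κ) M₂ (∑ i, ‖b i‖) (Real.exp (B9Ineq368Vprime.rateC (1 / 100) (33 / 100 * δ₀) * d₀))) (cCConc (Fintype.card κ) 1 α₁ a₀ Cq M₂ (∑ i, ‖b i‖) (Real.exp (B9Ineq368Vprime.rateC (1 / 100) (33 / 100 * δ₀) * d₀))) Λ (B6.c1 d δ₀ (1 / 100)) α₁)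
    α₁ d₀ M₂ kQ kF sQ sF cfun w
    hκQ hBG hB₁ hcF hCq ha₀ hα₁0 hΛ (by norm_num) (by norm_num) hδ₀ hδP0 hM₂
    hrG hr1 (by norm_num) (by norm_num) hρ₁0 hα''ρ hα''ρ2 hα''ρ3 hΛρ₁ hr368
    hrc1 hρc0 (by norm_num) (by norm_num) hrc hrcG hGδ1 hGδ1 (by norm_num) (by norm_num) (by norm_num) hc₄ hrCinv hc₁v hc₁v' hc₂ hcc'
    rfl rfl ha₁' rfl hdnn htri hrefl hsym hlen h261β h261'' h261c h261v h261v' hT1 hT2 hT1i hT2i hT4 hTρ₁ hT4v hrepr hη A hsmall hU1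
    h337B h337F h337Bτ hA hAτB hd₀B hd₀F hd₀0 h342_1 h342_2 h342_3 rep hrep h357 h357s hQc hQcs hFc hFcs hLinv h348 (h1.trans hhalf)
    hw hcard hkQ hkF hsQ hsF hcfun (h2.trans hhalf) (h3.trans hhalf) (le_add_of_nonneg_right hK3nn) (le_add_of_nonneg_left hK1nn)
  have hw1 : ∀ a : g.Site, 0 ≤ (g.len a)⁻¹ := fun a => inv_nonneg.mpr (hlen a).le
  have hKP : kappa349 κQ ((1 + Fintype.card κ) * BG) B₁ Λ (B6.c1 d δ₀ (1 / 100)) ≤ kappa349 κQ ((1 + Fintype.card κ) * BG) B₁ Λ (B6.c1 d δ₀ (1 / 100)) + K := le_add_of_nonneg_right hK0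
  have hKP' : (kappa368 κQ cF (kappa385 1 (cVConc (Fintype.card κ) 1 α₁ a₀ Cq M₂ (∑ i, ‖b i‖) (Real.exp (7 / 20 * δ₀ * d₀))) 0 0 Λ (B6.c1 d δ₀ (1 / 100))) (kappa366 κQ cF (kappa385 1 (cVConc (Fintype.card κ) 1 α₁ a₀ Cq M₂ (∑ i, ‖b i‖) (Real.exp (δ₀ * d₀))) 0 0 Λ (B6.c1 d δ₀ (1 / 100))) BG (BG * B6.c1 d (49 / 50 * δ₀) (1 / 100) * (1 - theta363 (Fintype.card κ) 1 α₁ a₀ Cq M₂ (∑ i, ‖b i‖) (Real.exp (δ₀ * d₀)) BG Λ (B6.c1 d δ₀ (1 / 100)) * B6.c1 d (49 / 50 * δ₀) (1 / 100))⁻¹) Λ (B6.c1 d δ₀ (1 / 100)) α₁) BG BG (BG * B6.c1 d (33 / 100 * δ₀) (1 / 100) * (1 - theta363 (Fintype.card κ) 1 α₁ a₀ Cq M₂ (∑ i, ‖b i‖) (Real.exp (7 / 20 * δ₀ * d₀)) BG Λ (B6.c1 d δ₀ (1 / 100)) * B6.c1 d (33 / 100 * δ₀) (1 / 100))⁻¹)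 B₁ (2 * B₁ * B6.c1 d ((1 / 2 - 1 / 10) * δ₀) (1 / 10)) Λ (B6.c1 d δ₀ (1 / 100)) α₁ + ↑(Fintype.card κ) * kappa368Ds κQ cF (kappa385 BG (cVConc (Fintype.card κ) 1 α₁ a₀ Cq M₂ (∑ i, ‖b i‖) (Real.exp (7 / 20 * δ₀ * d₀))) 0 0 Λ (B6.c1 d δ₀ (1 / 100))) (kappa366 κQ cF (kappa385 1 (cVConc (Fintype.card κ) 1 α₁ a₀ Cq M₂ (∑ i, ‖b i‖) (Real.exp (δ₀ * d₀))) 0 0 Λ (B6.c1 d δ₀ (1 / 100))) BG (BG * B6.c1 d (49 / 50 * δ₀) (1 / 100) * (1 - theta363 (Fintype.card κ) 1 α₁ a₀ Cq M₂ (∑ i, ‖b i‖) (Real.exp (δ₀ * d₀)) BG Λ (B6.c1 d δ₀ (1 / 100)) * B6.c1 d (49 / 50 * δ₀) (1 / 100))⁻¹) Λ (B6.c1 d δ₀ (1 / 100)) α₁) BG BG BG (B6.c1 d (33 / 100 * δ₀) (1 / 100) * (1 - theta363 (Fintype.card κ) 1 α₁ a₀ Cq M₂ (∑ i, ‖b i‖)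 (Real.exp (7 / 20 * δ₀ * d₀)) BG Λ (B6.c1 d δ₀ (1 / 100)) * B6.c1 d (33 / 100 * δ₀) (1 / 100))⁻¹) (BG * Λρ₁ ^ 2 * B6.c1 d (33 / 100 * δ₀) (1 / 100) * (1 - thetaL363 (Fintype.card κ) 1 α₁ a₀ Cq M₂ (∑ i, ‖b i‖) (Real.exp (7 / 20 * δ₀ * d₀)) BG Λ (B6.c1 d δ₀ (1 / 100)) * B6.c1 d (33 / 100 * δ₀) (1 / 100))⁻¹) B₁ (2 * B₁ * B6.c1 d ((1 / 2 - 1 / 10) * δ₀) (1 / 10)) (cBConc (Fintype.card κ) M₂ (∑ i, ‖b i‖) (Real.exp (B9Ineq368Vprime.rateC (1 / 100) (33 / 100 * δ₀) * d₀))) (cCConc (Fintype.card κ) 1 α₁ a₀ Cq M₂ (∑ i, ‖b i‖) (Real.exp (B9Ineq368Vprime.rateC (1 / 100) (33 / 100 * δ₀) * d₀))) Λ (B6.c1 d δ₀ (1 / 100)) α₁) * α₁ ≤ (kappa349 κQ ((1 + Fintype.card κ) * BG) B₁ Λ (B6.c1 d δ₀ (1 / 100)) + K) * α₁ := mul_le_mul_of_nonneg_right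 (h6.trans (le_add_of_nonneg_left hκP0)) hα₁0
  refine ⟨Tinv, hTl, hTr, ?_, ?_, ?_, ?_, ?_, ?_, ?_, ?_⟩
  · exact hasMajorant_mono (g := toB6 g Rr H) _ hP fun a a' => mul_le_mul_of_nonneg_right hKP (Real.exp_nonneg _)
  · exact hasMajorantHom_mono (g := toB6 g Rr H) _ _ hDP fun a a' =>
      mul_le_mul_of_nonneg_right (mul_le_mul_of_nonneg_right hKP (hw1 a)) (Real.exp_nonneg _)
  · exact hasMajorantHom_mono (g := toB6 g Rr H) _ _ hPDs fun a a' =>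
      mul_le_mul_of_nonneg_right (mul_le_mul_of_nonneg_right hKP (hw1 a)) (Real.exp_nonneg _)
  · exact hasMajorant_mono (g := toB6 g Rr H) _ hDPDs fun a a' =>
      mul_le_mul_of_nonneg_right (mul_le_mul_of_nonneg_right hKP (inv_nonneg.mpr (sq_nonneg _))) (Real.exp_nonneg _)
  · exact hasMajorant_mono (g := toB6 g Rr H) _ hPp fun a a' => mul_le_mul_of_nonneg_right hKP' (Real.exp_nonneg _)
  · exact hasMajorantHom_mono (g := toB6 g Rr H) _ _ hDPp fun a a' =>
      mul_le_mul_of_nonneg_right (mul_le_mul_of_nonneg_right hKP' (hw1 a)) (Real.exp_nonneg _)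
  · exact hasMajorantHom_mono (g := toB6 g Rr H) _ _ hPpDs fun a a' =>
      mul_le_mul_of_nonneg_right (mul_le_mul_of_nonneg_right hKP' (hw1 a)) (Real.exp_nonneg _)
  · exact hasMajorant_mono (g := toB6 g Rr H) _ hDPpDs fun a a' =>
      mul_le_mul_of_nonneg_right (mul_le_mul_of_nonneg_right hKP' (inv_nonneg.mpr (sq_nonneg _))) (Real.exp_nonneg _)

end Threshold

/-! ## §4  Theorem 3.4, `R(U)`-clause: (3.68) for `P′(A)` and (3.49) for `P(U′U)`, printed quantifiers -/

section Final

variable {𝔸 : Type*} [NormedRing 𝔸] [NormedAlgebra ℂ 𝔸] [CompleteSpace 𝔸] {ι : Type} [Fintype ι]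
variable (b : Module.Basis ι ℝ 𝔸) {S : Type} {κ : Type} [Fintype κ] [LinearOrder κ]
variable (T : κ → Equiv.Perm S) (U : κ → S → 𝔸ˣ)
variable {g : B9.Geometry} [Fintype g.Site] {Rr : ℝ} {H : Prop}

omit [LinearOrder κ] in
set_option maxHeartbeats 800000 in
/-- **THEOREM 3.4, THE `R(U)`-CLAUSE, CONCRETE PERTURBATION, PRINTED QUANTIFIERS** — p. 403 «the operators R(U), P(U) = I − R(U) extend analytically to
the domain (3.37) and satisfy the same bounds, e.g. the operator P(U′U) satisfies the bounds (3.49). Moreover we have P(U′U) = P(U) + P′(A), [(3.68)]»: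
given Theorem 3.1 (3.42)₁₋₃ for `G′(U)` and Theorem 3.2 for `U` ((3.21) `hLinv`, (3.48) kernel bound `B₁`) at the rate `δ₀`, [4] Lemma 2.1 and the
p. 398 scale transfer for every exponent, the (3.19) letters `Q′(U) : sites → 𝔅`, `Q′*(U) : 𝔅 → sites` (block-local, size `κ_Q`), a section `rep`
of the block map, the `A`-free (3.60) data: `∃ a₁ > 0 ∃ K ≧ 0 ∀ α₁ ∈ [0, a₁] ∀ A` in (3.37) (blockwise) `∀ kF sF` ((3.59) kernels) `∀` (3.57)/(3.59)
letters `Q′(U′U) = Q′ + F′₂`, `Q′*(U′U) = Q′* + F′₂*` (`F′₂, F′₂*` block-local of size `c_Fα₁`): THERE EXISTS `C⁻¹(U′U)`, two-sided inverse of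
`Q′(U′U)G′²(U′U)Q′*(U′U)` on 𝔅 (`G′(U′U) = gPrimeExtEnd G′ (V′G′)`, (3.64)), such that, with `D = conjHom b (gradLin T η⁻¹ U)`, `D* = conjHom b
(divLin T η⁻¹ U)` and all letters read on the sites through `rep`: **(3.68)** `P′(A) ≺ Kα₁e^{−(δ₀/4)d}`, `D·P′(A) ≺ Kα₁(Lʲη)⁻¹e^{−(δ₀/4)d}`,
`P′(A)·D* ≺ Kα₁(Lʲη)⁻¹e^{−(δ₀/4)d}`, `D·P′(A)·D* ≺ Kα₁(Lʲη)⁻²e^{−(δ₀/4)d}` for `P′(A) = pPrime G′ G′(U′U) Q′* Q′*(U′U) C⁻¹ C⁻¹(U′U) Q′ Q′(U′U)`, AND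
**(3.49) for `P(U′U)`** `= pOp G′(U′U) Q′*(U′U) C⁻¹(U′U) Q′(U′U) = G′(U′U)Q′*(U′U)C⁻¹(U′U)Q′(U′U)G′(U′U)` ((3.25) at `U′U`; `= P(U) + P′(A)` by
`B9Eq360Vprime.eq368`): `P(U′U) ≺ Ke^{−(δ₀/4)d}`, `D·P(U′U), P(U′U)·D* ≺ K(Lʲη)⁻¹e^{−(δ₀/4)d}`, `D·P(U′U)·D* ≺ K(Lʲη)⁻²e^{−(δ₀/4)d}` — ONE `K`,
independent of `α₁` and `A`.  PROOF: `exists_threshold_pPrime` with `a₁ ↦ min a₁ 1`, `K ↦ 2K`, `eq368`, the word identity `pOp G′ (Q′* ∘ rep*)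
(rep_! C⁻¹ rep*) (rep_! ∘ Q′) = G′ ∘ Q′* ∘ C⁻¹ ∘ Q′ ∘ G′` and `hasMajorant_add`/`hasMajorantHom_add`.
[cite: Balaban1985BackgroundPropagators, Thm 3.4 p.400 + (3.68) p.403 + (3.49) p.399 + (3.25) p.394 + Thm 3.1 (3.42) p.397 + Thm 3.2 (3.48) p.398 + p.398 remark + (3.19)/(3.21) pp.393–394 + (3.57)–(3.67) pp.401–403 + (3.37) p.396; Balaban1984PropagatorsII, Lemma 2.1 p.234 + (2.51)–(2.55) p.232 + (2.66) p.234; Balaban1985Variational, (135) p.298] -/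
theorem thm34_R_final [Fintype S] [DecidableEq S] [DecidableEq ι] [DecidableEq g.Site] [Nonempty g.Site] (blk : S → g.Site) (d : ℕ)
    (δ₀ κQ BG B₁ cF Cq a₀ d₀ M₂ : ℝ)
    (kQ : g.Site → S → 𝔸 →L[ℝ] 𝔸) (sQ : S → 𝔸 →L[ℝ] 𝔸) (cfun w : g.Site → ℝ)
    (hκQ : 0 < κQ) (hBG : 0 < BG) (hB₁ : 0 < B₁) (hcF : 0 < cF) (hCq : 0 ≤ Cq) (ha₀ : 0 ≤ a₀) (hM₂ : 0 ≤ M₂) (hδ₀ : 0 < δ₀)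
    -- the multiscale geometry 𝔅 and its axioms
    (hdnn : ∀ a a' : g.Site, 0 ≤ g.dist a a') (htri : Triangle254 (toB6 g Rr H)) (hrefl : ∀ y : g.Site, g.dist y y = 0)
    (hsym : ∀ y y' : g.Site, g.dist y y' = g.dist y' y) (hlen : ∀ y : g.Site, 0 < g.len y) (hlenη : ∀ y : g.Site, g.eta ≤ g.len y)
    (hη : 0 < g.eta)
    -- [4] Lemma 2.1 (2.61) at the rate `δ₀`, «for every 0 < α < 1», and the p. 398 scale transfer for every exponent
    (h261 : ∀ α : ℝ, 0 < α → α < 1 → Ineq261 d (toB6 g Rr H) δ₀ α)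
    (hST : ∀ α : ℝ, 0 < α → ∃ Λ : ℝ, 1 ≤ Λ ∧ ScaleTransfer g δ₀ α Λ (fun a => g.len a) ∧ ScaleTransfer g δ₀ α Λ (fun a => g.len a ^ 2) ∧
      ScaleTransfer g δ₀ α Λ (fun a => (g.len a)⁻¹) ∧ ScaleTransfer g δ₀ α Λ (fun a => (g.len a ^ 2)⁻¹) ∧
      ScaleTransfer g δ₀ α Λ (fun a => (g.len a ^ 4)⁻¹) ∧ ScaleTransfer g δ₀ α Λ (fun y => g.len y ^ (-(4 : ℝ))))
    (hrepr : ∀ (v : 𝔸) (i : ι), |b.repr v i| ≤ M₂ * ‖v‖)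
    (hU1 : ∀ m z, ‖((U m z : 𝔸ˣ) : 𝔸)‖ ≤ 1 ∧ ‖(((U m z)⁻¹ : 𝔸ˣ) : 𝔸)‖ ≤ 1)
    (hd₀B : ∀ μ x, g.dist (blk x) (blk ((T μ).symm x)) ≤ d₀) (hd₀F : ∀ μ x, g.dist (blk x) (blk (T μ x)) ≤ d₀)
    (hd₀0 : ∀ y : g.Site, g.dist y y ≤ d₀)
    -- the `A`-independent data of the concrete `V′(A)` of (3.60)
    (hw : ∀ y, 0 ≤ w y) (hcard : ∀ y, ((B9Eq360Vprime.block blk y).card : ℝ) * w y ≤ 1)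
    (hkQ : ∀ y x, blk x = y → ‖kQ y x‖ ≤ w y) (hsQ : ∀ x, ‖sQ x‖ ≤ 1) (hcfun : ∀ y, |cfun y| ≤ a₀ * (g.len y ^ 2)⁻¹)
    -- THEOREM 3.1 for `G′(U)`: (3.42)₁,₂,₃ at the rate `δ₀`
    {Gp : Module.End ℝ (S × ι → ℝ)}
    (h342_1 : HasMajorant (g := toB6 g Rr H) (fun p : S × ι => blk p.1) Gp
      (fun a a' => BG * g.len a ^ 2 * Real.exp (-(δ₀ * g.dist a a'))))
    (h342_2 : ∀ k : κ ⊕ κ, HasMajorant (g := toB6 g Rr H) (fun p : S × ι => blk p.1)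
      (conj b (diffLetter T U ((g.eta : ℂ)⁻¹) k) * Gp) (fun a a' => BG * g.len a * Real.exp (-(δ₀ * g.dist a a'))))
    (h342_3 : ∀ k : κ ⊕ κ, HasMajorant (g := toB6 g Rr H) (fun p : S × ι => blk p.1)
      (Gp * conj b (diffLetter T U ((g.eta : ℂ)⁻¹) k)) (fun a a' => BG * g.len a * Real.exp (-(δ₀ * g.dist a a'))))
    -- the (3.19) letters `Q′(U)`, `Q′*(U)` in their own typing with block-local two-space majorants, a section of the block map (FILE 17)
    (rep : g.Site → S × ι) (hrep : ∀ y : g.Site, blk (rep y).1 = y)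
    {Qc : (S × ι → ℝ) →ₗ[ℝ] (g.Site → ℝ)} {Qcs : (g.Site → ℝ) →ₗ[ℝ] (S × ι → ℝ)} {Linv : Module.End ℝ (g.Site → ℝ)}
    (hQc : HasMajorantHom (g := toB6 g Rr H) (fun p : S × ι => blk p.1) (fun y : g.Site => y) Qc
      (fun a a' : g.Site => κQ * (if a = a' then (1 : ℝ) else 0)))
    (hQcs : HasMajorantHom (g := toB6 g Rr H) (fun y : g.Site => y) (fun p : S × ι => blk p.1) Qcs
      (fun a a' : g.Site => κQ * (if a = a' then (1 : ℝ) else 0)))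
    -- THEOREM 3.2 for `U`: (3.21) `C⁻¹ = (Q′G′²Q′*)⁻¹` exists (`hLinv`) with the KERNEL bound (3.48) at the rate `δ₀`
    (hLinv : (Qc ∘ₗ (Gp * Gp) ∘ₗ Qcs) * Linv = 1)
    (h348 : ∀ y y' : g.Site, |B9Thm34Inv.ker (B9Thm34Inv.vol g d) Linv y y'| ≤
      B₁ * g.len y ^ (-(4 : ℝ)) * g.len y' ^ (-(d : ℝ)) * Real.exp (-(δ₀ * g.dist y y'))) :
    ∃ a₁ : ℝ, 0 < a₁ ∧ ∃ K : ℝ, 0 ≤ K ∧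
    ∀ (α₁ : ℝ), 0 ≤ α₁ → α₁ ≤ a₁ →
    -- the exponent field `A` in the domain (3.37), read blockwise, and the `A`-dependent (3.59) data `kF`, `sF`
    ∀ (A : κ → S → 𝔸) (kF : g.Site → S → 𝔸 →L[ℝ] 𝔸) (sF : S → 𝔸 →L[ℝ] 𝔸),
      (∀ y x, blk x = y → ‖kF y x‖ ≤ Cq * α₁ * w y) → (∀ x, ‖sF x‖ ≤ Cq * α₁) →
      (∀ ν k x, ‖((g.eta : ℂ)⁻¹) • covDstar T U ν (A k) x‖ ≤ α₁ * (g.len (blk x) ^ 2)⁻¹) →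
      (∀ μ ν x, ‖((g.eta : ℂ)⁻¹) • covD T U μ (A ν) x‖ ≤ α₁ * (g.len (blk x) ^ 2)⁻¹) →
      (∀ μ x, ‖((g.eta : ℂ)⁻¹) • covDstar T U μ (tauB T U μ (A μ)) x‖ ≤ α₁ * (g.len (blk x) ^ 2)⁻¹) →
      (∀ k x, ‖A k x‖ ≤ α₁ * (g.len (blk x))⁻¹) → (∀ ν k x, ‖tauB T U ν (A k) x‖ ≤ α₁ * (g.len (blk x))⁻¹) →
    -- the (3.57)/(3.59) letters `F′₂(A)`, `F′₂*(A)` (block-local, size `c_F α₁`)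
    ∀ {Qc' Fc : (S × ι → ℝ) →ₗ[ℝ] (g.Site → ℝ)} {Qcs' Fcs : (g.Site → ℝ) →ₗ[ℝ] (S × ι → ℝ)},
      Qc' = Qc + Fc → Qcs' = Qcs + Fcs →
      HasMajorantHom (g := toB6 g Rr H) (fun p : S × ι => blk p.1) (fun y : g.Site => y) Fc
        (fun a a' : g.Site => cF * α₁ * (if a = a' then (1 : ℝ) else 0)) →
      HasMajorantHom (g := toB6 g Rr H) (fun y : g.Site => y) (fun p : S × ι => blk p.1) Fcs
        (fun a a' : g.Site => cF * α₁ * (if a = a' then (1 : ℝ) else 0)) →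
    ∃ Tinv : Module.End ℝ (g.Site → ℝ),
      Tinv * (Qc' ∘ₗ ((gPrimeExtEnd Gp (conj b (vPrimeConc T U g.eta A blk kQ kF sQ sF cfun) * Gp)) * (gPrimeExtEnd Gp (conj b (vPrimeConc T U g.eta A blk kQ kF sQ sF cfun) * Gp))) ∘ₗ Qcs') = 1 ∧
      (Qc' ∘ₗ ((gPrimeExtEnd Gp (conj b (vPrimeConc T U g.eta A blk kQ kF sQ sF cfun) * Gp)) * (gPrimeExtEnd Gp (conj b (vPrimeConc T U g.eta A blk kQ kF sQ sF cfun) * Gp))) ∘ₗ Qcs') * Tinv = 1 ∧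
      HasMajorant (g := toB6 g Rr H) (fun p : S × ι => blk p.1) (B9Eq360Vprime.pPrime Gp (gPrimeExtEnd Gp (conj b (vPrimeConc T U g.eta A blk kQ kF sQ sF cfun) * Gp)) (Qcs ∘ₗ secRes rep) (Qcs' ∘ₗ secRes rep) (secConj rep Linv) (secConj rep Tinv) (secExt rep ∘ₗ Qc) (secExt rep ∘ₗ Qc'))
        (fun a a' => K * α₁ * Real.exp (-(1 / 4 * δ₀ * g.dist a a'))) ∧
      HasMajorantHom (g := toB6 g Rr H) (fun p : S × ι => blk p.1) (fun q : (κ × S) × ι => blk q.1.2)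
        (conjHom b (gradLin T ((g.eta : ℂ)⁻¹) U) ∘ₗ (B9Eq360Vprime.pPrime Gp (gPrimeExtEnd Gp (conj b (vPrimeConc T U g.eta A blk kQ kF sQ sF cfun) * Gp)) (Qcs ∘ₗ secRes rep) (Qcs' ∘ₗ secRes rep) (secConj rep Linv) (secConj rep Tinv) (secExt rep ∘ₗ Qc) (secExt rep ∘ₗ Qc')))
        (fun a a' => K * α₁ * (g.len a)⁻¹ * Real.exp (-(1 / 4 * δ₀ * g.dist a a'))) ∧
      HasMajorantHom (g := toB6 g Rr H) (fun q : (κ × S) × ι => blk q.1.2) (fun p : S × ι => blk p.1)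
        ((B9Eq360Vprime.pPrime Gp (gPrimeExtEnd Gp (conj b (vPrimeConc T U g.eta A blk kQ kF sQ sF cfun) * Gp)) (Qcs ∘ₗ secRes rep) (Qcs' ∘ₗ secRes rep) (secConj rep Linv) (secConj rep Tinv) (secExt rep ∘ₗ Qc) (secExt rep ∘ₗ Qc')) ∘ₗ conjHom b (divLin T ((g.eta : ℂ)⁻¹) U))
        (fun a a' => K * α₁ * (g.len a)⁻¹ * Real.exp (-(1 / 4 * δ₀ * g.dist a a'))) ∧
      HasMajorant (g := toB6 g Rr H) (fun q : (κ × S) × ι => blk q.1.2)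
        (conjHom b (gradLin T ((g.eta : ℂ)⁻¹) U) ∘ₗ (B9Eq360Vprime.pPrime Gp (gPrimeExtEnd Gp (conj b (vPrimeConc T U g.eta A blk kQ kF sQ sF cfun) * Gp)) (Qcs ∘ₗ secRes rep) (Qcs' ∘ₗ secRes rep) (secConj rep Linv) (secConj rep Tinv) (secExt rep ∘ₗ Qc) (secExt rep ∘ₗ Qc')) ∘ₗ conjHom b (divLin T ((g.eta : ℂ)⁻¹) U))
        (fun a a' => K * α₁ * (g.len a ^ 2)⁻¹ * Real.exp (-(1 / 4 * δ₀ * g.dist a a'))) ∧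
      HasMajorant (g := toB6 g Rr H) (fun p : S × ι => blk p.1) (B9Eq360Vprime.pOp (gPrimeExtEnd Gp (conj b (vPrimeConc T U g.eta A blk kQ kF sQ sF cfun) * Gp)) (Qcs' ∘ₗ secRes rep) (secConj rep Tinv) (secExt rep ∘ₗ Qc'))
        (fun a a' => K * Real.exp (-(1 / 4 * δ₀ * g.dist a a'))) ∧
      HasMajorantHom (g := toB6 g Rr H) (fun p : S × ι => blk p.1) (fun q : (κ × S) × ι => blk q.1.2)
        (conjHom b (gradLin T ((g.eta : ℂ)⁻¹) U) ∘ₗ (B9Eq360Vprime.pOp (gPrimeExtEnd Gp (conj b (vPrimeConc T U g.eta A blk kQ kF sQ sF cfun) * Gp)) (Qcs' ∘ₗ secRes rep) (secConj rep Tinv) (secExt rep ∘ₗ Qc')))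
        (fun a a' => K * (g.len a)⁻¹ * Real.exp (-(1 / 4 * δ₀ * g.dist a a'))) ∧
      HasMajorantHom (g := toB6 g Rr H) (fun q : (κ × S) × ι => blk q.1.2) (fun p : S × ι => blk p.1)
        ((B9Eq360Vprime.pOp (gPrimeExtEnd Gp (conj b (vPrimeConc T U g.eta A blk kQ kF sQ sF cfun) * Gp)) (Qcs' ∘ₗ secRes rep) (secConj rep Tinv) (secExt rep ∘ₗ Qc')) ∘ₗ conjHom b (divLin T ((g.eta : ℂ)⁻¹) U))
        (fun a a' => K * (g.len a)⁻¹ * Real.exp (-(1 / 4 * δ₀ * g.dist a a'))) ∧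
      HasMajorant (g := toB6 g Rr H) (fun q : (κ × S) × ι => blk q.1.2)
        (conjHom b (gradLin T ((g.eta : ℂ)⁻¹) U) ∘ₗ (B9Eq360Vprime.pOp (gPrimeExtEnd Gp (conj b (vPrimeConc T U g.eta A blk kQ kF sQ sF cfun) * Gp)) (Qcs' ∘ₗ secRes rep) (secConj rep Tinv) (secExt rep ∘ₗ Qc')) ∘ₗ conjHom b (divLin T ((g.eta : ℂ)⁻¹) U))
        (fun a a' => K * (g.len a ^ 2)⁻¹ * Real.exp (-(1 / 4 * δ₀ * g.dist a a'))) := by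
  obtain ⟨a₁, ha₁, K, hK0, h⟩ := exists_threshold_pPrime (Rr := Rr) (H := H) b T U blk d δ₀ κQ BG B₁ cF Cq a₀ d₀ M₂ kQ sQ cfun w
    hκQ hBG hB₁ hcF hCq ha₀ hM₂ hδ₀ hdnn htri hrefl hsym hlen hlenη hη h261 hST hrepr hU1 hd₀B hd₀F hd₀0 hw hcard hkQ hsQ hcfun
    h342_1 h342_2 h342_3 rep hrep hQc hQcs hLinv h348
  -- the word of `P(U)` through the section IS `G′Q′*C⁻¹Q′G′` (FILE 17 `word_secConj`, here for `pOp`'s bracketing)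
  have hinj : Function.Injective rep := fun y₁ y₂ h => by rw [← hrep y₁, ← hrep y₂, h]
  have hPw : B9Eq360Vprime.pOp Gp (Qcs ∘ₗ secRes rep) (secConj rep Linv) (secExt rep ∘ₗ Qc) = Gp ∘ₗ Qcs ∘ₗ Linv ∘ₗ Qc ∘ₗ Gp :=
    LinearMap.ext fun F => by
      simp only [B9Eq360Vprime.pOp, Module.End.mul_apply, LinearMap.comp_apply, secConj_def, secRes_secExt_apply hinj]
  refine ⟨min a₁ 1, lt_min ha₁ one_pos, 2 * K, by positivity, ?_⟩
  intro α₁ hα₁0 hα₁1 A kF sF hkF hsF h337B h337F h337Bτ hA hAτB Qc' Fc Qcs' Fcs h357 h357s hFc hFcs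
  obtain ⟨Tinv, hTl, hTr, hP, hDP, hPDs, hDPDs, hPp, hDPp, hPpDs, hDPpDs⟩ := h α₁ hα₁0 (hα₁1.trans (min_le_left _ _)) A kF sF hkF hsF
    h337B h337F h337Bτ hA hAτB h357 h357s hFc hFcs
  have hα₁le : α₁ ≤ 1 := hα₁1.trans (min_le_right _ _)
  have hw1 : ∀ a : g.Site, 0 ≤ (g.len a)⁻¹ := fun a => inv_nonneg.mpr (hlen a).le
  -- constant bookkeeping: `Kα₁ ≦ 2Kα₁`, `K + Kα₁ ≦ 2K` (α₁ ≦ 1)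
  have j2 : ∀ li e : ℝ, 0 ≤ li → 0 ≤ e → K * α₁ * li * e ≤ 2 * K * α₁ * li * e := fun li e hli he => by
    nlinarith [mul_nonneg (mul_nonneg (mul_nonneg hK0 hα₁0) hli) he]
  have j1 : ∀ e : ℝ, 0 ≤ e → K * α₁ * e ≤ 2 * K * α₁ * e := fun e he => by
    simpa using j2 1 e zero_le_one he
  have j4 : ∀ li e : ℝ, 0 ≤ li → 0 ≤ e → K * li * e + K * α₁ * li * e ≤ 2 * K * li * e := fun li e hli he => by
    nlinarith [mul_nonneg (mul_nonneg hK0 hli) he, mul_le_mul_of_nonneg_right hα₁le (mul_nonneg (mul_nonneg hK0 hli) he)]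
  have j3 : ∀ e : ℝ, 0 ≤ e → K * e + K * α₁ * e ≤ 2 * K * e := fun e he => by
    simpa using j4 1 e zero_le_one he
  -- `P(U′U) = P(U) + P′(A)` ((3.68), first line) and `P(U)`'s word through the section
  have h368 : (B9Eq360Vprime.pOp (gPrimeExtEnd Gp (conj b (vPrimeConc T U g.eta A blk kQ kF sQ sF cfun) * Gp)) (Qcs' ∘ₗ secRes rep) (secConj rep Tinv) (secExt rep ∘ₗ Qc')) = (Gp ∘ₗ Qcs ∘ₗ Linv ∘ₗ Qc ∘ₗ Gp) + (B9Eq360Vprime.pPrime Gp (gPrimeExtEnd Gp (conj b (vPrimeConc T U g.eta A blk kQ kF sQ sF cfun) * Gp)) (Qcs ∘ₗ secRes rep) (Qcs' ∘ₗ secRes rep) (secConj rep Linv) (secConj rep Tinv) (secExt rep ∘ₗ Qc) (secExt rep ∘ₗ Qc')) := by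
    rw [B9Eq360Vprime.eq368 Gp _ (Qcs ∘ₗ secRes rep) _ (secConj rep Linv) _ (secExt rep ∘ₗ Qc) _, hPw]
  refine ⟨Tinv, hTl, hTr, ?_, ?_, ?_, ?_, ?_, ?_, ?_, ?_⟩
  · exact hasMajorant_mono (g := toB6 g Rr H) _ hPp fun a a' => j1 _ (Real.exp_nonneg _)
  · exact hasMajorantHom_mono (g := toB6 g Rr H) _ _ hDPp fun a a' => j2 _ _ (hw1 a) (Real.exp_nonneg _)
  · exact hasMajorantHom_mono (g := toB6 g Rr H) _ _ hPpDs fun a a' => j2 _ _ (hw1 a) (Real.exp_nonneg _)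
  · exact hasMajorant_mono (g := toB6 g Rr H) _ hDPpDs fun a a' => j2 _ _ (inv_nonneg.mpr (sq_nonneg _)) (Real.exp_nonneg _)
  · rw [h368]
    exact hasMajorant_mono (g := toB6 g Rr H) _ (B6RandomWalk.hasMajorant_add _ hP hPp) fun a a' => j3 _ (Real.exp_nonneg _)
  · rw [h368, LinearMap.comp_add]
    exact hasMajorantHom_mono (g := toB6 g Rr H) _ _ (B6RandomWalkHom.hasMajorantHom_add _ _ hDP hDPp) fun a a' =>
      j4 _ _ (hw1 a) (Real.exp_nonneg _)
  · rw [h368, LinearMap.add_comp]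
    exact hasMajorantHom_mono (g := toB6 g Rr H) _ _ (B6RandomWalkHom.hasMajorantHom_add _ _ hPDs hPpDs) fun a a' =>
      j4 _ _ (hw1 a) (Real.exp_nonneg _)
  · rw [h368, LinearMap.add_comp, LinearMap.comp_add]
    exact hasMajorant_mono (g := toB6 g Rr H) _ (B6RandomWalk.hasMajorant_add _ hDPDs hDPpDs) fun a a' =>
      j4 _ _ (inv_nonneg.mpr (sq_nonneg _)) (Real.exp_nonneg _)

end Final

end Literature.MathematicalPhysics.QuantumFieldTheory.Balaban1983to89.B9Thm34RFinal
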